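import Mathlib
import Literature.MathematicalPhysics.QuantumFieldTheory.Balaban1983to89.T4EtaRateMin
import Literature.MathematicalPhysics.QuantumFieldTheory.Balaban1983to89.T4LipschitzLedger

/-!
# `Balaban1983to89.T4SupCloseLiaison` — kernel glue for the T4-DAG edge U1b → U5b/U5.E: the (η) shell ledger's only
two-run input, the binder (F∞) `T4LipschitzLedger.SupClose`, IS node U1b's η-rate shape `T4EtaRateMin.LocalRate` read
at the slot's own level under ONE unprinted realisation convention, with the GEOMETRIC WIDTH `ρ_j = (C/θ_min)·ϑ^j` —
hence `ρ ≥ 0`, `Σ_j ρ_j = (C/θ_min)(1 − ϑ)⁻¹`, the rate form `ρ_j ≤ c₁ϑ^j`, and the band weight of design (η) geometric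
in `K` (cell `pub-balaban`, unit `b2b-balaban-pv25-g11` = the U1b lineage that owns `T4EtaRateMin`; self-proposed liaison
row T4-U1b.S-FINFTY° under the yield clause of T4-DAG v18 §8 Q24 — T4-DAG §6 NE3 (v5): «(F∞) … NE3's species, NOT PRINTED,
no new count; to be typed by the U1b lineage»; NO NEW ESTIMATE, nothing about the audited construction asserted; imports
`T4EtaRateMin` (pv25) and `T4LipschitzLedger` (pv07) only)

HONEST FRAMING (cell `pub-balaban`, T4-DAG PAGE 1).  The cell's T4 target is rung (B)+1: existence AND uniqueness of the
continuum limit of Bałaban's unit-scale averaged loop expectations on a FIXED finite torus — strictly beyond ultraviolet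
stability ([Balaban1988Convergent] Cor. 3 p. 264; [Balaban1989LargeFieldII] Thm 1 p. 355); NOT infinite volume, NOT a
mass gap, NOT the Clay problem.  NOTHING of the run-A/run-B comparison is printed: the manuscripts construct ONE run.
VALUE of this leaf = typed glue between two hypothesis-shape modules of different lineages (a seam of the T4-DAG closed
BY NAME), NOT summit progress.

WHAT THIS MODULE IS.  Node U1b's output shape is `T4EtaRateMin.LocalRate R C ϑ`: for ONE reading family `R` (admissible
data `R.dom`, local readings `R.loc k V x` of the `k`-step run driven by the unit-lattice datum `V` at the unit-scale
site `x`), consecutive runs' local readings of the SAME datum differ by at most `C ϑ^k` at every site (NOT PRINTED for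
Bałaban's minimisers — B11 prints η-UNIFORM regularity, `t4/T4-XREAD-U1b.md`; printed linear TEMPLATE = King's (3.71);
cell GAPS G-t4-U1b-1; T4-DAG §6 NE3 = OSC(‖·‖ ∈ {E, (115)})).  Node U5b's design (η) consumes, as its ONLY two-run input,
the binder `T4LipschitzLedger.SupClose T μ m slot θ uA uB ρ` ((F∞) IN RELATIVE FORM BY LEVEL: almost everywhere on the
space of term `τ ∈ T K`, the two runs' tested variables of factor `i` — a slot of age `a_i = (slot K τ i).1 ≤ K`, hence
of LEVEL `j = K − a_i` — differ by at most `ρ(j)·θ_i`) together with `0 ≤ ρ` and `Summable ρ`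
(`T4LipschitzLedger.shellWeightBound_of_repr`, `cauchy_of_repr`), and the shell-measure route consumes the RATE FORM
`ρ_j ≤ c₁ϑ^j` (`T4ShellMeasure.levelSum_le_geometric`, cell GAPS G-ne7cp1-1, G-pv07-6 and G-pv07-6′: «(F∞)-rate, NE3 species»).  The
cell records state the dictionary between the two shapes IN WORDS (GAPS G-pv07-6: «the two runs' local minimisers (2.16)
at the same level-lattice data; NE3 species … an addition to node U1b's list of readings, owner U1b lineages»); here it
is kernel-checked, exactly as the gen-3 liaison `T4RateLiaison.GaugeDominated` did for the edge U1b → U3: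

* `ReadsLevels R T μ m slot uA uB` — THE ONE UNPRINTED REALISATION CONVENTION (data identities, a `def … : Prop`, never
  asserted): for a.e. point `v` of the space of term `τ ∈ T K` and every factor `i < m K τ`, there are an ADMISSIBLE datum
  `V ∈ R.dom` and a site `x` with `uA K τ i v = R.loc (K − a_i) V x` and `uB K τ i v = R.loc (K − a_i + 1) V x`: the
  slot's tested variable in run A (K steps; the factor is born at run A's step `j = K − a_i`) is the reading of the
  `j`-step minimiser, in run B (K + 1 steps; born at its step `j + 1`) the reading of the `(j+1)`-step minimiser, both at
  the level-`j` unit-lattice datum the coupling of node U5a makes common to the two runs (T4-DAG §1 D8: the same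
  threshold numbers and cube families) and at the slot's cube.  WHICH functionals are slots is the census
  `t4/T4-XREAD-U5X15.md` §1 (kinds A1–A3, A6, A7, B4, B5, B11, B15); the model functional is B14 (2.17)'s
  `u_□ = sup_{p ⊂ □∼} |U_{k,□}(V_k, ∂p) − 1|` in threshold units common to both runs (curvature normalised by `η²`).
  `ReadsLevelsRel` is the variant with readings pre-normalised by the slot's threshold (`u = θ_i · r`).
* `ThresholdFloor T m θ θmin` — the synchronised thresholds of the live window are bounded below by ONE number
  `θmin > 0`, uniformly in `K` (LOCATED INPUT, see HONEST LIMITS (b)).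
* `geomWidth C θmin ϑ j = (C/θmin)·ϑ^j` — the width, with `geomWidth_nonneg`, `geomWidth_le_rate` (the rate form, `c₁ =
  C/θmin`), `geomWidth_le_const` (`ρ_j ≤ ρ̄ = C/θmin`, the bounded-width socket of `T4ShellSuppressionRoute` §7),
  `geomWidth_antitone`, `summable_geomWidth`, `tsum_geomWidth`, `tendsto_geomWidth`.
* (L1) `supClose_of_localRate` — `LocalRate R C ϑ` + `ReadsLevels` + `ThresholdFloor` (`θmin > 0`) ⟹
  `SupClose T μ m slot θ uA uB (geomWidth C θmin ϑ)`; `supClose_of_localRate_symm` (runs swapped, `SupClose.symm`);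
  `supClose_of_localRate_rel` — the pre-normalised variant gives `SupClose … (fun j ↦ C ϑ^j)` with NO floor.  The scalar
  core is `abs_sub_le_geomWidth_mul`; no sign hypothesis on `C` or `ϑ` is needed for (L1).
* (L2) BY NAME INTO pv07's LEDGER: `shellWeightBound_of_localRate` = `T4LipschitzLedger.shellWeightBound_of_repr` with its
  three two-run binders `hF : SupClose`, `hρ0 : 0 ≤ ρ`, `hρ : Summable ρ` DISCHARGED from `LocalRate` (`0 ≤ C`,
  `0 ≤ ϑ < 1`) + the convention + the floor; `cauchy_of_localRate` = `T4LipschitzLedger.cauchy_of_repr` likewise (END TO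
  END under design (η): matching modulo constants, summable remainders, the Cauchy property and uniform convergence of
  the generating functions on `|t| ≤ l₀` — every remaining estimate a binder, now WITHOUT a free two-run width).
* (L3) THE PRICE IN CLOSED FORM: `tsum_bandWeight_eq` — `Σ_K Wsh_K = C₀(n, L·S) · (C/θmin)(1 − ϑ)⁻¹`
  (`T4LipschitzCutoff.tsum_weight_eq` ∘ `tsum_geomWidth`); `bandWeight_le_geometric` — for `ϑ > 0`,
  `Wsh_K ≤ [(C/θmin) Σ_{a ≤ N} n_a L_a S_a ϑ^{−a}] · ϑ^K`, the «(F∞)-rate» form the NE7c seats book (geometric in `K` at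
  the cost `ϑ^{−N}` of the window, cf. `T4ShellMeasure.levelSum_le_geometric`).
* §4 NON-VACUITY / NON-TRIVIALITY on a one-slot toy (one term per step, one factor of age `0`, threshold `1`, Dirac
  reference measure): the geometric readings `(1/2)^k` of `T4EtaRateMin.Witness.geom` realise `ReadsLevels`, meet the
  floor, and (L1) returns `SupClose` with width `(1/2)^j` (`Toy.supClose_geom`, all binders of (L1) inhabited at once);
  the rate-free readings `k` of `T4EtaRateMin.Witness.linear` admit `SupClose` for NO summable width
  (`Toy.not_supClose_summable_linear`) — the conjunction «`SupClose` ∧ `Summable ρ`» the ledger consumes has content.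
* §5 (v1.1, self-row T4-U1b.S-FINFTY-DECAY°; acting on the cross-read C-pv01-78 (iii) of v1) A KERNEL-TRUE WEAKENING OF THE
  FLOOR — A THRESHOLD DECAYING SLOWER THAN NE3's RATE ALSO GIVES A SUMMABLE WIDTH (KERNEL IMPLICATION ONLY — v1.2 DOCFIX
  D1, cell GAPS O-pv16g12-10; what it does NOT locate is the next bullet): `ThresholdDecay T m slot θ θmin σ` (the
  threshold of a factor of level `j` is at least `θmin·σ^j`; `σ = 1` ⇔ `ThresholdFloor`: `ThresholdFloor.decay_one`,
  `ThresholdDecay.floor_of_one`; `.mono_rate`, `.thr_pos`); scalar core `abs_sub_le_geomWidth_div_mul`; (L1-decay)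
  `supClose_of_localRate_decay` — `LocalRate R C ϑ` + `ReadsLevels` + `ThresholdDecay θmin σ` (`θmin, σ > 0`) ⟹
  `SupClose … (geomWidth C θmin (ϑ/σ))`, a width summable as soon as `ϑ < σ` (`summable_geomWidth_div`); by name into
  pv07's ledger exactly as (L2): `shellWeightBound_of_localRate_decay`, `cauchy_of_localRate_decay` (ρ :=
  `geomWidth C θmin (ϑ/σ)`; (L3)'s closed form and geometric-in-`K` bound apply verbatim with `ϑ/σ` for `ϑ`); the
  real-analysis lemma `exists_geom_le_inv_pow_succ` (`0 < σ < 1`, `p : ℕ` ⟹ `∃ c > 0, ∀ k, c·σ^k ≤ ((k+1)^p)⁻¹`) and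
  `thresholdDecay_of_polyLower`: thresholds bounded below by `A·(j+1)^{−p}` IN THE LEVEL `j` (`A > 0`) satisfy
  `ThresholdDecay` for EVERY `σ ∈ (0,1)`.  [v1.2 DOCFIX D1 — v1.1's sentence at this place, «HONEST LIMITS (b) is
  RE-LOCATED (cell GAPS G-pv25g11-2′): what the edge U1b → U5b needs of the thresholds is NOT a `K`-uniform floor … but
  AT MOST POLYNOMIAL DECAY IN THE LEVEL, a statement about the running-coupling sequence behind B14 (2.17)'s
  `ε_k = A₀g_kp₀(g_k)`», is WITHDRAWN (cross-read C-pv16g12-9 / O-pv16g12-10, CONCEDED): the hypothesis of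
  `thresholdDecay_of_polyLower` is LEVEL-indexed — its demand is LARGEST, `θ ≥ A`, at level `0` — whereas B14 (2.17)'s
  threshold runs with the coupling OF THE FACTOR'S LEVEL and, under asymptotic freedom at fixed physical coupling (the
  cell's running-coupling books, BETA-SPEC `Step.Discrete031`: `1/g_k² ≍ 1/g² + b(K − k)`), is polynomially small in the
  AGE `K − k`, vanishing at level `0` as `K → ∞` — exactly where the decay form still demands the floor value; C-pv01-78
  (iii) is CONFIRMED, not relaxed; G-pv25g11-2′ is withdrawn as a re-location and HONEST LIMITS (b) / cell GAPS
  G-pv25g11-2 stand unchanged.]  Toy: `θ_K = (3/4)^K` decays with `(θmin, σ) = (1, 3/4)`, has NO positive floor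
  (`Toy.not_thresholdFloor_dec`), and (L1-decay) still returns a summable width `(2/3)^j` for the geometric readings
  (`Toy.supClose_decay`, `Toy.summable_width_decay`) — a kernel fact about the implication, not a located input.
* §5d–§5e (v1.2, self-row T4-U1b.S-FINFTY-AGE°; acting on the cross-read O-pv16g12-10 of v1.1) AGE-INDEXED THRESHOLDS:
  THE WINDOW, NOT DECAY, IS THE BOOKING.  `AgeLower T m slot θ f` (the threshold of a factor of AGE `a` is at least
  `f a` — the (2.17)+AF TYPE; a `def … : Prop`, NOT asserted); `AgeWindow T m slot N` (every live factor has age `≤ N`)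
  with `ageWindow_of_termRepr` — pv07's `TermRepr.slot_mem` IS node U2's window; `thresholdFloor_of_ageLower_window`
  (age-indexed lower bound + window + `θmin ≤ f a` for `a ≤ N` ⟹ `ThresholdFloor θmin`),
  `exists_thresholdFloor_of_ageLower_window` (`f > 0` on the window ⟹ SOME positive floor, the minimum over the finitely
  many ages), `thresholdFloor_of_agePolyLower_window` (`θ ≥ A·(a+1)^{−p}` in the AGE + window `N` ⟹ floor `A·(N+1)^{−p}`:
  the window converts age-smallness into the `K`-uniform floor of HONEST LIMITS (b) at the price `(N+1)^p` in `C/θmin` —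
  the cross-read's item (3c) in the kernel); (L1-age) `supClose_of_localRate_ageLower`; (L2-age)
  `shellWeightBound_of_localRate_ageLower` / `cauchy_of_localRate_ageLower` — (L2) with the floor binder DISCHARGED from
  `AgeLower f` + `0 < θmin ≤ f a (a ≤ N)` through the window ALREADY INSIDE the two `TermRepr` hypotheses (no separate
  window binder).  §5e NEGATIVE WITNESSES (kernel; the cross-reader's probe J4 re-typed in the tree): a one-slot toy whose
  factor has AGE `K` (level `0`, born deepest-UV, the oldest factor) with threshold `(K+1)⁻¹` satisfies `AgeLower` with
  `f a = (a+1)⁻¹` (`Toy.ageLower_old`) but has NO age window (`Toy.not_ageWindow_old`), NO `ThresholdDecay` for any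
  `θmin > 0` and any `σ` (`Toy.not_thresholdDecay_old`), hence no positive floor (`Toy.not_thresholdFloor_old`), and —
  although its readings `(1/2)^k` have NE3's shape (`Toy.localRate_geom`) — NO `SupClose` width `ρ` WHATSOEVER
  (`Toy.not_supClose_old`: a LEVEL-indexed width cannot absorb an AGE-indexed vanishing threshold); the v1 toy (age `0`,
  threshold `1`) obeys the SAME age law, has the window `N = 0`, and (L1-age) returns the width `(1/2)^j`
  (`Toy.supClose_geom_age`).  Without the window neither form is dischargeable from age-indexed thresholds; with it the
  floor is (cell GAPS G-pv25g11-2; UPDATE row G-pv25g11-2″ withdrawing G-pv25g11-2′).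

INDEXING (recorded for the carver; consistent with `T4RateLiaison`'s INDEXING REMARK, creation-level reading).  A factor
of age `a` in the `K`-th comparison sits at LEVEL `j = K − a` (`T4LipschitzLedger.SupClose` indexes `ρ` by it; the age
cap `TermRepr.slot_band : a ≤ K` makes the truncated subtraction honest): run A has performed `j` steps when the factor's
characteristic function is introduced, run B `j + 1`; the pair compared in the slot is therefore `LocalRate`'s pair at
run index `j`, uniformly in the admissible datum — the «η-rate at the indicator's own level» of T4-DAG §1 D10 / §6 NE3
(v5).  For fixed age the level grows with `K`, so `ρ(K − a) = (C/θmin)ϑ^{K−a} → 0`: recent slots are tight, old slots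
(large `a`, bounded by the window `a ≤ N`) cost `ϑ^{−N}` — (L3).

SCOPE / HONEST LIMITS.  (a) No statement about Bałaban's (or King's) constructions is asserted: `LocalRate` (NE3, NOT
PRINTED), `ReadsLevels` / `ReadsLevelsRel` (conventions), `ThresholdFloor`, `TermRepr`, `SiblingSuppression`,
`RelWeightBound`, the remainder sandwich, positivity, `Summable δ` and `W + Wsh < 1` are BINDERS of the theorems; the
module proves real bookkeeping only ([folklore]; zero `sorry`, no new axioms).  (b) LOCATED, NOT PRINTED — the floor:
B14 (2.17) p. 257 puts the threshold of the model slot at `ε_kη²` with `ε_k = A₀g_kp₀(g_k)` a function of the RUNNING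
COUPLING of the slot's level (cell GAPS G-ne7cp1-1); in units common to both runs a `K`-UNIFORM positive floor over the
live window `K − N ≤ j ≤ K` is an input about the coupling flow at fixed torus (node U2's convergence of the running
couplings at fixed physical scale + the window bound `N`), not a printed sentence — cell GAPS G-pv25g11-2 (v1.2:
CONFIRMED against the cross-read O-pv16g12-10 — §5's decay form does not remove this input; its age-indexed dictionary
THROUGH the window is §5d's `thresholdFloor_of_agePolyLower_window`; G-pv25g11-2′ withdrawn); the pre-normalised
variant `supClose_of_localRate_rel` needs no floor but asks NE3 of the threshold-normalised readings `u/θ`, a different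
instance of the same shape.  (c) LOCATED — a.e. admissibility: `ReadsLevels` asks the realised datum
to lie in `R.dom` for `μ K τ`-a.e. `v`; where the term's own small-field factors vanish nothing printed constrains the
configuration, so either the reference measure of `TermRepr` (which that convention leaves free) is taken supported where
the datum is admissible, or NE3 is asked on a larger class — cell GAPS G-pv25g11-3.  (d) Which slot functionals are
readings of the NE3 family and in which currency NE3 bounds them (the sup / OSC_(115) channel with one covariant
derivative, `t4/T4-EST-U1b.md` §1.3 (F)) is the U1b EST rows' business and the X-15 census, not this leaf.  (e) No count
of T4-DAG §6 changes: «(F∞)-rate» on the NE7c wall IS NE3(F) at the slot's level plus (b), (c) — one Prop fewer to name,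
none fewer to prove.

CITATION HEADER (lean-in-tree rule 2026-08-18).  Read as images by this seat (unit `b2b-balaban-pv25-g11`): the render
`b2b-balaban-ref1/pages/1988-cmp119-convergent-renormalization/1988-cmp119-convergent-renormalization-p015-x2.png` =
journal p. 257 of T. Bałaban, *Convergent renormalization expansions for lattice gauge theories*, Commun. Math. Phys.
**119** (1988) 243–285 [Balaban1988Convergent] (cell paper B14; PDF page = journal page − 242), quoted VERBATIM for
CONTEXT and SHAPE only: *"χ_k(Ω_k) = ∏_{□⊂Ω_k} χ({sup_{p⊂□∼} |U_{k,□}(V_k, ∂p) − 1| < ε_kη²}) , (2.17) where the cubes □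
belong to the partition of the lattice T_η into cubes of the size LM₂R_k."* — the model of a background-mediated slot:
its tested variable is a LOCAL functional of the step-`k` minimiser `U_{k,□}(V_k)` of (2.16) *"U_{k,□}(V_k) =
U(B_k(□^{∼4}), M·(Q^{s*}_k V_k))"* driven by the unit-lattice datum `V_k`, i.e. a `Readings.loc k V □`; and the render
`b2b-balaban-template/king-renders/1986-cmp102-king-u1-higgs-I-p016-x2.png` = p. 664 of C. King, *The U(1) Higgs
model. I. The continuum limit*, Commun. Math. Phys. **102** (1986) 649–677 [King1986] (PUBLISHED, outside the audited
series), Prop. 3.8: *"For x′, y′ ∈ T_{η′}, 0 < α < 1, and γ sufficiently small, |a_{k+n}G^{η′}_{k+n}Q*_{k+n}(x′, z) −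
a_kG^η_kQ*_k(x, z)|, … ≦ CL^{−γk} exp[−δ₀{|x − z|, dist({x, y}, z)}]. (3.71)"* — the printed linear TEMPLATE of a local
reading of two runs differing by a GEOMETRIC rate in the run index (`LocalRate`'s shape with `ϑ = L^{−γ}`; module
`T4EtaRateMin`).  The manuscripts are quoted for CONTEXT and SHAPE only; no disputed estimate of theirs is used anywhere
below, and nothing printed is asserted.  ABSOLUTE RULE respected: no internally-minted statement enters as a cited fact.

THE ROW SERVED (journal `CLAIMS.log` 2026-08-19, unit `b2b-balaban-pv25-g11`, self-proposed under the yield clause of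
T4-DAG v18 §8 Q24 — the t4-carver may rename/book it; one writer = the pv25 lineage): "T4-U1b.S-FINFTY° | U1b → U5b/U5.E |
LIAISON (kernel, S) | (F∞) = `T4LipschitzLedger.SupClose` and its rate form TYPED as NE3 `T4EtaRateMin.LocalRate` at the
slot's level under the realisation convention `ReadsLevels` + the threshold floor; pv07's `shellWeightBound_of_repr` /
`cauchy_of_repr` with the two-run width discharged by name; closed-form and geometric-in-`K` price | `T4EtaRateMin`
(pv25), `T4LipschitzLedger` (pv07) | S".
-/

open MeasureTheory Finset Filter Topology

namespace Literature.MathematicalPhysics.QuantumFieldTheory.Balaban1983to89.T4SupCloseLiaison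

open T4EtaRateMin (Readings LocalRate NE3Shape)
open T4LipschitzLedger (Pol SupClose TermRepr sibW shellW)
open T4LipschitzCutoff (SiblingSuppression lipWeight)
open T4IndicatorShell (ShellWeightBound)
open T4WeightBudget (RelWeightBound)
open T4HybridMatching (hybridDelta)
open T4CauchySum (MatchingModConstants genFun genFunLim)
open T4ShellCount (C0)

/-! ## §1 The geometric two-run width by level -/

section Width

/-- THE GEOMETRIC TWO-RUN WIDTH BY LEVEL: `ρ_j = (C/θmin)·ϑ^j` — NE3's constant and rate, divided by the threshold floor
(relative form). [folklore] -/
noncomputable def geomWidth (C θmin ϑ : ℝ) (j : ℕ) : ℝ := C / θmin * ϑ ^ j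

/-- Unfolding the width. [folklore] -/
@[simp] theorem geomWidth_apply (C θmin ϑ : ℝ) (j : ℕ) : geomWidth C θmin ϑ j = C / θmin * ϑ ^ j := rfl

/-- `ρ ≥ 0` (the binder `hρ0` of `T4LipschitzLedger.shellWeightBound_of_repr`). [folklore] -/
theorem geomWidth_nonneg {C θmin ϑ : ℝ} (hC : 0 ≤ C) (hθ : 0 ≤ θmin) (hϑ : 0 ≤ ϑ) (j : ℕ) :
    0 ≤ geomWidth C θmin ϑ j :=
  mul_nonneg (div_nonneg hC hθ) (pow_nonneg hϑ j)

/-- THE RATE FORM `ρ_j ≤ c₁ϑ^j` with `c₁ = C/θmin` (the socket `hρ` of `T4ShellMeasure.levelSum_le_geometric`). [folklore] -/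
theorem geomWidth_le_rate (C θmin ϑ : ℝ) (j : ℕ) : geomWidth C θmin ϑ j ≤ C / θmin * ϑ ^ j := le_rfl

/-- BOUNDED WIDTH `ρ_j ≤ ρ̄ := C/θmin` for `0 ≤ ϑ ≤ 1` (the socket `hρ` of `T4ShellSuppressionRoute` §7). [folklore] -/
theorem geomWidth_le_const {C θmin ϑ : ℝ} (hC : 0 ≤ C) (hθ : 0 ≤ θmin) (hϑ0 : 0 ≤ ϑ) (hϑ1 : ϑ ≤ 1) (j : ℕ) :
    geomWidth C θmin ϑ j ≤ C / θmin :=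
  mul_le_of_le_one_right (div_nonneg hC hθ) (pow_le_one₀ hϑ0 hϑ1)

/-- The width is non-increasing in the level for `0 ≤ ϑ ≤ 1`. [folklore] -/
theorem geomWidth_antitone {C θmin ϑ : ℝ} (hC : 0 ≤ C) (hθ : 0 ≤ θmin) (hϑ0 : 0 ≤ ϑ) (hϑ1 : ϑ ≤ 1) :
    Antitone (geomWidth C θmin ϑ) :=
  fun _ _ hij => mul_le_mul_of_nonneg_left (pow_le_pow_of_le_one hϑ0 hϑ1 hij) (div_nonneg hC hθ)

/-- `Summable ρ` (the binder `hρ` of `T4LipschitzLedger.shellWeightBound_of_repr`) for `0 ≤ ϑ < 1`. [folklore] -/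
theorem summable_geomWidth {C θmin ϑ : ℝ} (hϑ0 : 0 ≤ ϑ) (hϑ1 : ϑ < 1) : Summable (geomWidth C θmin ϑ) :=
  (summable_geometric_of_lt_one hϑ0 hϑ1).mul_left (C / θmin)

/-- THE TOTAL TWO-RUN WIDTH OVER LEVELS in closed form: `Σ_j ρ_j = (C/θmin)(1 − ϑ)⁻¹`. [folklore] -/
theorem tsum_geomWidth {C θmin ϑ : ℝ} (hϑ0 : 0 ≤ ϑ) (hϑ1 : ϑ < 1) :
    ∑' j, geomWidth C θmin ϑ j = C / θmin * (1 - ϑ)⁻¹ := by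
  rw [show geomWidth C θmin ϑ = fun j => C / θmin * ϑ ^ j from rfl, tsum_mul_left,
    tsum_geometric_of_lt_one hϑ0 hϑ1]

/-- The width tends to `0` along the levels. [folklore] -/
theorem tendsto_geomWidth {C θmin ϑ : ℝ} (hϑ0 : 0 ≤ ϑ) (hϑ1 : ϑ < 1) :
    Tendsto (geomWidth C θmin ϑ) atTop (𝓝 0) :=
  (summable_geomWidth hϑ0 hϑ1).tendsto_atTop_zero

/-- SCALAR CORE OF THE LIAISON: a consecutive-run discrepancy `≤ C ϑ^j` is, relative to any threshold `θ ≥ θmin > 0`,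
at most `geomWidth C θmin ϑ j · θ`.  No sign hypothesis on `C` or `ϑ`. [folklore] -/
theorem abs_sub_le_geomWidth_mul {C ϑ θmin θ x y : ℝ} {j : ℕ} (h : |y - x| ≤ C * ϑ ^ j) (hmin : 0 < θmin)
    (hθ : θmin ≤ θ) : |x - y| ≤ geomWidth C θmin ϑ j * θ := by
  have h0 : 0 ≤ C * ϑ ^ j := (abs_nonneg _).trans h
  have hw : geomWidth C θmin ϑ j = C * ϑ ^ j / θmin := by simp only [geomWidth]; ring
  have hw0 : 0 ≤ geomWidth C θmin ϑ j := by rw [hw]; exact div_nonneg h0 hmin.le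
  calc |x - y| = |y - x| := abs_sub_comm x y
    _ ≤ C * ϑ ^ j := h
    _ = geomWidth C θmin ϑ j * θmin := by rw [hw, div_mul_cancel₀ _ hmin.ne']
    _ ≤ geomWidth C θmin ϑ j * θ := mul_le_mul_of_nonneg_left hθ hw0

end Width

/-! ## §2 The realisation convention and the liaison (L1) -/

section Liaison

variable {Dat Sit : Type*} {ι : Type*} {Ω : ℕ → ι → Type*} [∀ K τ, MeasurableSpace (Ω K τ)]

/-- **REALISATION CONVENTION, ABSOLUTE FORM** (UNPRINTED; data identities, a `def … : Prop`, never asserted).  For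
almost every point `v` of the space of term `τ ∈ T K` and every factor `i < m K τ` — a slot of age `a_i = (slot K τ i).1`,
level `j = K − a_i` — there are an ADMISSIBLE datum `V ∈ R.dom` and a site `x` such that run A's tested variable is the
local reading of the `j`-step run and run B's that of the `(j+1)`-step run of the reading family `R`, at `(V, x)`:
the two runs' slot functionals are the local minimiser functionals of B14 (2.16)–(2.17) at the same level-lattice datum
(node U5a's coupling), in threshold units common to both runs. [folklore] -/
def ReadsLevels (R : Readings Dat Sit) (T : ℕ → Finset ι) (μ : (K : ℕ) → (τ : ι) → Measure (Ω K τ))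
    (m : ℕ → ι → ℕ) (slot : ℕ → ι → ℕ → Σ _ : ℕ, ℕ) (uA uB : (K : ℕ) → (τ : ι) → ℕ → Ω K τ → ℝ) : Prop :=
  ∀ K, ∀ τ ∈ T K, ∀ i < m K τ, ∀ᵐ v ∂(μ K τ), ∃ V ∈ R.dom, ∃ x : Sit,
    uA K τ i v = R.loc (K - (slot K τ i).1) V x ∧ uB K τ i v = R.loc (K - (slot K τ i).1 + 1) V x

/-- **REALISATION CONVENTION, PRE-NORMALISED FORM** (UNPRINTED; never asserted): as `ReadsLevels`, the tested variables
being the slot's threshold times the readings (`u = θ_i · r`: the family `R` reads threshold-normalised functionals).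
[folklore] -/
def ReadsLevelsRel (R : Readings Dat Sit) (T : ℕ → Finset ι) (μ : (K : ℕ) → (τ : ι) → Measure (Ω K τ))
    (m : ℕ → ι → ℕ) (slot : ℕ → ι → ℕ → Σ _ : ℕ, ℕ) (θ : ℕ → ι → ℕ → ℝ)
    (uA uB : (K : ℕ) → (τ : ι) → ℕ → Ω K τ → ℝ) : Prop :=
  ∀ K, ∀ τ ∈ T K, ∀ i < m K τ, ∀ᵐ v ∂(μ K τ), ∃ V ∈ R.dom, ∃ x : Sit,
    uA K τ i v = θ K τ i * R.loc (K - (slot K τ i).1) V x ∧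
      uB K τ i v = θ K τ i * R.loc (K - (slot K τ i).1 + 1) V x

/-- **THRESHOLD FLOOR OVER THE LIVE WINDOW** (LOCATED INPUT, NOT PRINTED as a `K`-uniform statement — B14 (2.17):
`ε_k = A₀g_kp₀(g_k)` runs with the coupling; cell GAPS G-pv25g11-2): every threshold of every factor of every term is at
least `θmin`. [folklore] -/
def ThresholdFloor (T : ℕ → Finset ι) (m : ℕ → ι → ℕ) (θ : ℕ → ι → ℕ → ℝ) (θmin : ℝ) : Prop :=
  ∀ K, ∀ τ ∈ T K, ∀ i < m K τ, θmin ≤ θ K τ i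

/-- A floor may be lowered. [folklore] -/
theorem ThresholdFloor.mono {T : ℕ → Finset ι} {m : ℕ → ι → ℕ} {θ : ℕ → ι → ℕ → ℝ} {θmin θmin' : ℝ}
    (h : ThresholdFloor T m θ θmin) (hle : θmin' ≤ θmin) : ThresholdFloor T m θ θmin' :=
  fun K τ hτ i hi => hle.trans (h K τ hτ i hi)

/-- A positive floor makes every threshold positive (the field `TermRepr.thr_pos` of pv07's convention). [folklore] -/
theorem ThresholdFloor.thr_pos {T : ℕ → Finset ι} {m : ℕ → ι → ℕ} {θ : ℕ → ι → ℕ → ℝ} {θmin : ℝ}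
    (h : ThresholdFloor T m θ θmin) (hmin : 0 < θmin) : ∀ K, ∀ τ ∈ T K, ∀ i < m K τ, 0 < θ K τ i :=
  fun K τ hτ i hi => hmin.trans_le (h K τ hτ i hi)

variable {R : Readings Dat Sit} {C ϑ θmin : ℝ} {T : ℕ → Finset ι} {μ : (K : ℕ) → (τ : ι) → Measure (Ω K τ)}
  {m : ℕ → ι → ℕ} {slot : ℕ → ι → ℕ → Σ _ : ℕ, ℕ} {θ : ℕ → ι → ℕ → ℝ}
  {uA uB : (K : ℕ) → (τ : ι) → ℕ → Ω K τ → ℝ}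

/-- **(L1) THE LIAISON U1b → U5b.**  Node U1b's `LocalRate R C ϑ`, realised through `ReadsLevels`, with a positive
threshold floor `θmin`, gives the (η) ledger's two-run binder (F∞) `T4LipschitzLedger.SupClose` with the geometric width
`ρ_j = (C/θmin)ϑ^j`.  No sign hypothesis on `C` or `ϑ`. [folklore] -/
theorem supClose_of_localRate (hloc : LocalRate R C ϑ) (hR : ReadsLevels R T μ m slot uA uB) (hmin : 0 < θmin)
    (hθ : ThresholdFloor T m θ θmin) : SupClose T μ m slot θ uA uB (geomWidth C θmin ϑ) := by
  intro K τ hτ i hi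
  filter_upwards [hR K τ hτ i hi] with v hv
  obtain ⟨V, hV, x, hX, hY⟩ := hv
  rw [hX, hY]
  exact abs_sub_le_geomWidth_mul (hloc _ V hV x) hmin (hθ K τ hτ i hi)

/-- (L1, runs swapped) — `SupClose` is symmetric (`T4LipschitzLedger.SupClose.symm`). [folklore] -/
theorem supClose_of_localRate_symm (hloc : LocalRate R C ϑ) (hR : ReadsLevels R T μ m slot uA uB) (hmin : 0 < θmin)
    (hθ : ThresholdFloor T m θ θmin) : SupClose T μ m slot θ uB uA (geomWidth C θmin ϑ) :=
  (supClose_of_localRate hloc hR hmin hθ).symm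

/-- **(L1, pre-normalised)** — with threshold-normalised readings NO floor is needed and the width is NE3's `C ϑ^j`
itself (thresholds only nonnegative). [folklore] -/
theorem supClose_of_localRate_rel (hloc : LocalRate R C ϑ) (hR : ReadsLevelsRel R T μ m slot θ uA uB)
    (hθ : ∀ K, ∀ τ ∈ T K, ∀ i < m K τ, 0 ≤ θ K τ i) : SupClose T μ m slot θ uA uB (fun j => C * ϑ ^ j) := by
  intro K τ hτ i hi
  filter_upwards [hR K τ hτ i hi] with v hv
  obtain ⟨V, hV, x, hX, hY⟩ := hv
  have h1 := hloc (K - (slot K τ i).1) V hV x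
  have hθi := hθ K τ hτ i hi
  rw [hX, hY, ← mul_sub, abs_mul, abs_of_nonneg hθi, abs_sub_comm]
  calc θ K τ i * |R.loc (K - (slot K τ i).1 + 1) V x - R.loc (K - (slot K τ i).1) V x|
      ≤ θ K τ i * (C * ϑ ^ (K - (slot K τ i).1)) := mul_le_mul_of_nonneg_left h1 hθi
    _ = C * ϑ ^ (K - (slot K τ i).1) * θ K τ i := by ring

end Liaison

/-! ## §3 By name into the (η) ledger: (L2) the two-run width discharged, (L3) the price in closed form -/

section EndToEnd

variable {Dat Sit : Type*} {ι : Type*} {Ω : ℕ → ι → Type*} [∀ K τ, MeasurableSpace (Ω K τ)]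
  {l₀ vol : ℝ} {T : ℕ → Finset ι} {A B : ℕ → ℝ → ι → ℝ} {χ : ℕ → ℝ → ℝ} {κ Lχ : ℕ → ℝ} {N : ℕ} {n : ℕ → ℕ}
  {μ : (K : ℕ) → (τ : ι) → Measure (Ω K τ)} {m : ℕ → ι → ℕ} {slot : ℕ → ι → ℕ → Σ _ : ℕ, ℕ}
  {pol : ℕ → ι → ℕ → Pol} {θ : ℕ → ι → ℕ → ℝ} {uA uB : (K : ℕ) → (τ : ι) → ℕ → Ω K τ → ℝ}
  {RA RB : (K : ℕ) → ℝ → (τ : ι) → Ω K τ → ℝ} {S W δ : ℕ → ℝ} {Bad : ℕ → ℝ → Finset ι}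
  {R : Readings Dat Sit} {C ϑ θmin : ℝ}

/-- **(L2) `T4LipschitzLedger.shellWeightBound_of_repr` WITH THE TWO-RUN WIDTH DISCHARGED.**  Two represented runs on
the common spaces, node U1b's `LocalRate R C ϑ` (`0 ≤ C`, `0 ≤ ϑ < 1`) realised through `ReadsLevels` with a positive
threshold floor, and `SiblingSuppression` of the realized shell-restricted siblings at the geometric width in both runs
⇒ the literal `T4IndicatorShell.ShellWeightBound` for the realized shell parts with band weight
`K ↦ Σ_{a≤N} n_a · lipWeight L S (geomWidth C θmin ϑ) a K`.  The binders `hF`, `hρ0`, `hρ` of pv07's constructor are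
now `supClose_of_localRate`, `geomWidth_nonneg`, `summable_geomWidth`. [folklore] -/
theorem shellWeightBound_of_localRate (hA : TermRepr l₀ T A χ κ Lχ N n μ m slot pol θ uA uB RA)
    (hB : TermRepr l₀ T B χ κ Lχ N n μ m slot pol θ uB uA RB)
    (hloc : LocalRate R C ϑ) (hC : 0 ≤ C) (hϑ0 : 0 ≤ ϑ) (hϑ1 : ϑ < 1)
    (hR : ReadsLevels R T μ m slot uA uB) (hmin : 0 < θmin) (hθ : ThresholdFloor T m θ θmin)
    (hSA : SiblingSuppression l₀ T A N n (sibW χ κ μ m slot pol θ uA RA (geomWidth C θmin ϑ)) S)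
    (hSB : SiblingSuppression l₀ T B N n (sibW χ κ μ m slot pol θ uB RB (geomWidth C θmin ϑ)) S)
    (hS : ∀ a ≤ N, 0 ≤ S a) :
    ShellWeightBound l₀ T A B (shellW χ μ m slot pol θ uA uB RA) (shellW χ μ m slot pol θ uB uA RB)
      (fun K => ∑ a ∈ range (N + 1), (n a : ℝ) * lipWeight Lχ S (geomWidth C θmin ϑ) a K) :=
  T4LipschitzLedger.shellWeightBound_of_repr hA hB (supClose_of_localRate hloc hR hmin hθ) hSA hSB hS
    (geomWidth_nonneg hC hmin.le hϑ0) (summable_geomWidth hϑ0 hϑ1)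

/-- **(L2, END TO END) `T4LipschitzLedger.cauchy_of_repr` WITH THE TWO-RUN WIDTH DISCHARGED** (CONDITIONAL kernel
theorem; every estimate a binder).  An NE7b output `RelWeightBound`; two represented runs; node U1b's `LocalRate`
realised through `ReadsLevels` with a positive threshold floor; sibling suppression at the geometric width; the band
weight small enough; the partition-function identities and positivity (cell input L1-pos); summable `δ` (node U4′); the
a.e. remainder sandwich on the good terms (node U5b's factor ledgers) ⇒ matching modulo constants with remainders
`hybridDelta vol δ (W + Wsh)`, their summability, the Cauchy property of every generating-function sequence on
`|t| ≤ l₀` and uniform convergence there.  Nothing of Bałaban's is asserted. [folklore] -/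
theorem cauchy_of_localRate [DecidableEq ι] {Z : ℕ → ℝ → ℝ} (hvol : 0 < vol) (hl₀ : 0 ≤ l₀)
    (hW : RelWeightBound l₀ T A B Bad W)
    (hA : TermRepr l₀ T A χ κ Lχ N n μ m slot pol θ uA uB RA) (hB : TermRepr l₀ T B χ κ Lχ N n μ m slot pol θ uB uA RB)
    (hloc : LocalRate R C ϑ) (hC : 0 ≤ C) (hϑ0 : 0 ≤ ϑ) (hϑ1 : ϑ < 1)
    (hR : ReadsLevels R T μ m slot uA uB) (hmin : 0 < θmin) (hθ : ThresholdFloor T m θ θmin)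
    (hSA : SiblingSuppression l₀ T A N n (sibW χ κ μ m slot pol θ uA RA (geomWidth C θmin ϑ)) S)
    (hSB : SiblingSuppression l₀ T B N n (sibW χ κ μ m slot pol θ uB RB (geomWidth C θmin ϑ)) S)
    (hS : ∀ a ≤ N, 0 ≤ S a)
    (hlt : ∀ K, W K + ∑ a ∈ range (N + 1), (n a : ℝ) * lipWeight Lχ S (geomWidth C θmin ϑ) a K < 1)
    (hZA : ∀ K t, |t| ≤ l₀ → Z K t = ∑ τ ∈ T K, A K t τ)
    (hZB : ∀ K t, |t| ≤ l₀ → Z (K + 1) t = ∑ τ ∈ T K, B K t τ)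
    (hpos : ∀ K t, |t| ≤ l₀ → 0 < ∑ τ ∈ T K, A K t τ) (hδ : Summable δ) {c : ℕ → ℝ}
    (hsw : ∀ K t, |t| ≤ l₀ → ∀ τ ∈ T K \ Bad K t,
      (∀ᵐ v ∂(μ K τ), Real.exp (c K - vol * δ K) * RA K t τ v ≤ RB K t τ v) ∧
        (∀ᵐ v ∂(μ K τ), RB K t τ v ≤ Real.exp (c K + vol * δ K) * RA K t τ v)) :
    MatchingModConstants vol l₀
        (hybridDelta vol δ (fun K => W K + ∑ a ∈ range (N + 1), (n a : ℝ) * lipWeight Lχ S (geomWidth C θmin ϑ) a K))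
        Z ∧
      Summable
        (hybridDelta vol δ (fun K => W K + ∑ a ∈ range (N + 1), (n a : ℝ) * lipWeight Lχ S (geomWidth C θmin ϑ) a K)) ∧
      (∀ t : ℝ, |t| ≤ l₀ → CauchySeq fun K => genFun Z K t) ∧
      TendstoUniformlyOn (fun K t => genFun Z K t) (genFunLim Z) atTop {t | |t| ≤ l₀} :=
  T4LipschitzLedger.cauchy_of_repr hvol hl₀ hW hA hB (supClose_of_localRate hloc hR hmin hθ) hSA hSB hS
    (geomWidth_nonneg hC hmin.le hϑ0) (summable_geomWidth hϑ0 hϑ1) hlt hZA hZB hpos hδ hsw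

/-- **(L3) THE EXACT TWO-RUN COST OF DESIGN (η) IN CLOSED FORM:** `Σ_K Wsh_K = C₀(n, L·S) · (C/θmin)(1 − ϑ)⁻¹` — cube
count × Lipschitz constant × sibling suppression summed over the window once, times NE3's total width over levels
(`T4LipschitzCutoff.tsum_weight_eq` with `Σ_j ρ_j` evaluated by `tsum_geomWidth`). [folklore] -/
theorem tsum_bandWeight_eq {N : ℕ} (n : ℕ → ℕ) (Lχ S : ℕ → ℝ) {C θmin ϑ : ℝ} (hϑ0 : 0 ≤ ϑ) (hϑ1 : ϑ < 1) :
    ∑' K, (∑ a ∈ range (N + 1), (n a : ℝ) * lipWeight Lχ S (geomWidth C θmin ϑ) a K)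
      = C0 N (fun a => (n a : ℝ)) (fun a => Lχ a * S a) * (C / θmin * (1 - ϑ)⁻¹) := by
  rw [T4LipschitzCutoff.tsum_weight_eq n Lχ S (summable_geomWidth hϑ0 hϑ1), tsum_geomWidth hϑ0 hϑ1]

/-- **(L3′) THE «(F∞)-RATE» FORM: THE BAND WEIGHT IS GEOMETRIC IN `K`.**  For `ϑ > 0` and nonnegative data,
`Wsh_K ≤ [(C/θmin) Σ_{a≤N} n_a L_a S_a ϑ^{−a}] · ϑ^K` — recent slots are tight, the window of ages costs `ϑ^{−N}`
(cf. `T4ShellMeasure.levelSum_le_geometric`). [folklore] -/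
theorem bandWeight_le_geometric {N : ℕ} (n : ℕ → ℕ) {Lχ S : ℕ → ℝ} {C θmin ϑ : ℝ} (hL : ∀ a ≤ N, 0 ≤ Lχ a)
    (hS : ∀ a ≤ N, 0 ≤ S a) (hC : 0 ≤ C) (hmin : 0 < θmin) (hϑ0 : 0 < ϑ) (K : ℕ) :
    ∑ a ∈ range (N + 1), (n a : ℝ) * lipWeight Lχ S (geomWidth C θmin ϑ) a K
      ≤ (C / θmin * ∑ a ∈ range (N + 1), (n a : ℝ) * (Lχ a * S a * ϑ⁻¹ ^ a)) * ϑ ^ K := by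
  have hterm : ∀ a ∈ range (N + 1), (n a : ℝ) * lipWeight Lχ S (geomWidth C θmin ϑ) a K
      ≤ (n a : ℝ) * (Lχ a * S a * ϑ⁻¹ ^ a) * (C / θmin) * ϑ ^ K := by
    intro a ha
    have haN : a ≤ N := Finset.mem_range_succ_iff.1 ha
    have hLa := hL a haN
    have hSa := hS a haN
    unfold lipWeight
    split_ifs with haK
    · have hpow : ϑ ^ (K - a) = ϑ⁻¹ ^ a * ϑ ^ K := by
        rw [pow_sub₀ _ hϑ0.ne' haK, inv_pow, mul_comm]
      rw [geomWidth_apply, hpow]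
      exact le_of_eq (by ring)
    · rw [mul_zero]
      have hϑ' : 0 ≤ ϑ⁻¹ ^ a := pow_nonneg (inv_nonneg.2 hϑ0.le) a
      have : 0 ≤ C / θmin := div_nonneg hC hmin.le
      positivity
  calc ∑ a ∈ range (N + 1), (n a : ℝ) * lipWeight Lχ S (geomWidth C θmin ϑ) a K
      ≤ ∑ a ∈ range (N + 1), (n a : ℝ) * (Lχ a * S a * ϑ⁻¹ ^ a) * (C / θmin) * ϑ ^ K := sum_le_sum hterm
    _ = (C / θmin * ∑ a ∈ range (N + 1), (n a : ℝ) * (Lχ a * S a * ϑ⁻¹ ^ a)) * ϑ ^ K := by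
        rw [mul_sum, sum_mul]
        exact sum_congr rfl fun a _ => by ring

end EndToEnd

/-! ## §4 Non-vacuity and non-triviality on a one-slot toy -/

namespace Toy

open T4EtaRateMin.Witness (geom linear)

/-- Toy: one term per step. [folklore] -/
abbrev T : ℕ → Finset Unit := fun _ => {()}
/-- Toy: Dirac reference measure on the one-point space. [folklore] -/
noncomputable abbrev μ : (K : ℕ) → (τ : Unit) → Measure ((fun _ _ => Unit) K τ) := fun _ _ => Measure.dirac ()
/-- Toy: one factor per term. [folklore] -/
abbrev m : ℕ → Unit → ℕ := fun _ _ => 1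
/-- Toy: the factor has age `0` (its level is `K`) and copy index `0`. [folklore] -/
abbrev slot : ℕ → Unit → ℕ → Σ _ : ℕ, ℕ := fun _ _ _ => ⟨0, 0⟩
/-- Toy: threshold `1`. [folklore] -/
abbrev θ : ℕ → Unit → ℕ → ℝ := fun _ _ _ => 1
/-- Toy: run A reads the `K`-step reading of the family `R`, … [folklore] -/
abbrev uA (R : Readings Unit Unit) : (K : ℕ) → (τ : Unit) → ℕ → (fun _ _ => Unit) K τ → ℝ :=
  fun K _ _ _ => R.loc K () ()
/-- Toy: … run B the `(K+1)`-step one. [folklore] -/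
abbrev uB (R : Readings Unit Unit) : (K : ℕ) → (τ : Unit) → ℕ → (fun _ _ => Unit) K τ → ℝ :=
  fun K _ _ _ => R.loc (K + 1) () ()

/-- Any family with all data admissible is realised by the toy slot. [folklore] -/
theorem readsLevels (R : Readings Unit Unit) (hR : R.dom = Set.univ) :
    ReadsLevels (Ω := fun _ _ => Unit) R T μ m slot (uA R) (uB R) := by
  intro K τ _ i _
  exact ae_of_all _ fun v => ⟨(), by simp [hR], (), by simp, by simp⟩

/-- The toy thresholds have floor `1`. [folklore] -/
theorem thresholdFloor : ThresholdFloor T m θ 1 := fun _ _ _ _ _ => le_rfl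

/-- NON-VACUITY OF (L1): the geometric readings `(1/2)^k` (`T4EtaRateMin.Witness.ne3Shape`) give `SupClose` with width
`geomWidth 1 1 (1/2) j = (1/2)^j` — all binders of `supClose_of_localRate` inhabited at once. [folklore] -/
theorem supClose_geom :
    SupClose (Ω := fun _ _ => Unit) T μ m slot θ (uA geom) (uB geom) (geomWidth 1 1 (1 / 2)) :=
  supClose_of_localRate T4EtaRateMin.Witness.ne3Shape.pointwise (readsLevels geom rfl) one_pos thresholdFloor

/-- … and that width is `(1/2)^j`, summable with total `2`. [folklore] -/
theorem geomWidth_toy (j : ℕ) : geomWidth 1 1 (1 / 2) j = (1 / 2) ^ j := by simp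

/-- … with total `2`. [folklore] -/
theorem tsum_geomWidth_toy : ∑' j, geomWidth 1 1 (1 / 2 : ℝ) j = 2 := by
  rw [tsum_geomWidth (by norm_num) (by norm_num)]; norm_num

/-- NON-TRIVIALITY: the rate-free readings `k` (`T4EtaRateMin.Witness.linear`) realised by the same toy slot admit
`SupClose` for NO summable width — the conjunction «`SupClose` ∧ `Summable ρ`» consumed by the (η) ledger has content.
[folklore] -/
theorem not_supClose_summable_linear :
    ¬ ∃ ρ : ℕ → ℝ, Summable ρ ∧ SupClose (Ω := fun _ _ => Unit) T μ m slot θ (uA linear) (uB linear) ρ := by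
  rintro ⟨ρ, hρ, h⟩
  have h1 : ∀ K, (1 : ℝ) ≤ ρ K := by
    intro K
    have hK : ∀ᵐ v ∂(Measure.dirac ()),
        |uA linear K () 0 v - uB linear K () 0 v| ≤ ρ (K - (slot K () 0).1) * θ K () 0 :=
      h K () (Finset.mem_singleton_self _) 0 Nat.one_pos
    obtain ⟨_, hv⟩ := hK.exists
    have hval : uA linear K () 0 () - uB linear K () 0 () = -1 := by
      simp only [uA, uB, linear]; push_cast; ring
    have hval' : |uA linear K () 0 () - uB linear K () 0 ()| = 1 := by rw [hval]; norm_num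
    simpa [hval'] using hv
  obtain ⟨K, hK⟩ := (hρ.tendsto_atTop_zero.eventually (gt_mem_nhds one_pos)).exists
  exact (not_lt.2 (h1 K)) hK

end Toy

/-! ## §5 (v1.1) A kernel-true weakening of the floor: a threshold decaying slower than NE3's rate
(v1.2 DOCFIX D1: KERNEL IMPLICATION ONLY — for what it does not locate see §5d)

Row T4-U1b.S-FINFTY-DECAY° (journal `CLAIMS.log` 2026-08-19, unit `b2b-balaban-pv25-g11`, self-proposed under the yield
clause; acting on the cross-read of v1, cell GAPS C-pv01-78 item (iii): «book the FLOOR form … K-uniform only WITH the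
window a ≤ N»).  The (η) ledger consumes `SupClose` RELATIVE to the slot's threshold together with `Summable ρ`; a floor
makes `ρ_j = (C/θmin)ϑ^j`, but any lower bound `θ ≥ θmin σ^j` BY LEVEL gives `ρ_j = (C/θmin)(ϑ/σ)^j`, summable iff the
thresholds decay SLOWER than NE3's rate (`ϑ < σ`).  A threshold bounded below by a negative power OF THE LEVEL decays
slower than every geometric sequence (`exists_geom_le_inv_pow_succ`).  [v1.2 DOCFIX D1, cell GAPS O-pv16g12-10
CONCEDED: v1.1 called the last hypothesis «the TYPE of B14 (2.17)'s `ε_k = A₀g_kp₀(g_k)` under a logarithmically running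
coupling» — WRONG INDEX: that threshold runs with the coupling of the factor's LEVEL and, under asymptotic freedom at
fixed physical coupling, is polynomially small in the AGE `K − j`, NOT in the level `j` (it vanishes at level `0` as
`K → ∞`, where `ThresholdDecay` still demands the full `θmin`); whether and how Bałaban's sequence runs is the β cell's
business and is NOT asserted; the age-indexed dictionary, through node U2's window, is §5d, and the located input remains
the floor on the window (HONEST LIMITS (b), cell GAPS G-pv25g11-2).]  All [folklore]; nothing printed asserted; every v1
declaration above unchanged. -/

section Decay

variable {Dat Sit : Type*} {ι : Type*} {Ω : ℕ → ι → Type*} [∀ K τ, MeasurableSpace (Ω K τ)]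

/-- **THRESHOLD DECAY BY LEVEL** (a KERNEL-TRUE WEAKENING of `ThresholdFloor`; a `def … : Prop`, never asserted — v1.2
DOCFIX D1: NOT a located input of the cell; v1.1's label «LOCATED INPUT replacing the floor; cell GAPS G-pv25g11-2′» is
withdrawn per the cross-read O-pv16g12-10 — the located input stays the floor on node U2's window, cell GAPS G-pv25g11-2,
§5d): the threshold of factor `i` of term `τ ∈ T K` — a slot of age `a_i = (slot K τ i).1`, level `j = K − a_i` — is at
least `θmin · σ^j` (the demand is LARGEST at level `0`, the oldest factors).  `σ = 1` is `ThresholdFloor`. [folklore] -/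
def ThresholdDecay (T : ℕ → Finset ι) (m : ℕ → ι → ℕ) (slot : ℕ → ι → ℕ → Σ _ : ℕ, ℕ) (θ : ℕ → ι → ℕ → ℝ)
    (θmin σ : ℝ) : Prop :=
  ∀ K, ∀ τ ∈ T K, ∀ i < m K τ, θmin * σ ^ (K - (slot K τ i).1) ≤ θ K τ i

variable {T : ℕ → Finset ι} {m : ℕ → ι → ℕ} {slot : ℕ → ι → ℕ → Σ _ : ℕ, ℕ} {θ : ℕ → ι → ℕ → ℝ} {θmin σ : ℝ}

/-- A floor is decay with rate `σ = 1`. [folklore] -/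
theorem ThresholdFloor.decay_one (h : ThresholdFloor T m θ θmin) : ThresholdDecay T m slot θ θmin 1 :=
  fun K τ hτ i hi => by rw [one_pow, mul_one]; exact h K τ hτ i hi

/-- Decay with rate `σ = 1` is a floor. [folklore] -/
theorem ThresholdDecay.floor_of_one (h : ThresholdDecay T m slot θ θmin 1) : ThresholdFloor T m θ θmin :=
  fun K τ hτ i hi => by have := h K τ hτ i hi; rwa [one_pow, mul_one] at this

/-- A slower comparison rate may be replaced by a faster one (`σ' ≤ σ`, `θmin ≥ 0`). [folklore] -/
theorem ThresholdDecay.mono_rate {σ' : ℝ} (h : ThresholdDecay T m slot θ θmin σ) (hθ : 0 ≤ θmin) (hσ' : 0 ≤ σ')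
    (hle : σ' ≤ σ) : ThresholdDecay T m slot θ θmin σ' :=
  fun K τ hτ i hi =>
    (mul_le_mul_of_nonneg_left (pow_le_pow_left₀ hσ' hle _) hθ).trans (h K τ hτ i hi)

/-- The constant may be lowered (`σ ≥ 0`). [folklore] -/
theorem ThresholdDecay.mono_const {θmin' : ℝ} (h : ThresholdDecay T m slot θ θmin σ) (hσ : 0 ≤ σ)
    (hle : θmin' ≤ θmin) : ThresholdDecay T m slot θ θmin' σ :=
  fun K τ hτ i hi => (mul_le_mul_of_nonneg_right hle (pow_nonneg hσ _)).trans (h K τ hτ i hi)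

/-- Positive decay data make every threshold positive (the field `TermRepr.thr_pos` of pv07's convention). [folklore] -/
theorem ThresholdDecay.thr_pos (h : ThresholdDecay T m slot θ θmin σ) (hmin : 0 < θmin) (hσ : 0 < σ) :
    ∀ K, ∀ τ ∈ T K, ∀ i < m K τ, 0 < θ K τ i :=
  fun K τ hτ i hi => (mul_pos hmin (pow_pos hσ _)).trans_le (h K τ hτ i hi)

/-- SCALAR CORE (decay form): a discrepancy `≤ C ϑ^j` is, relative to any threshold `θ ≥ θmin σ^j` (`θmin, σ > 0`), at
most `geomWidth C θmin (ϑ/σ) j · θ`.  No sign hypothesis on `C` or `ϑ`. [folklore] -/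
theorem abs_sub_le_geomWidth_div_mul {C ϑ σ θmin θ x y : ℝ} {j : ℕ} (h : |y - x| ≤ C * ϑ ^ j) (hmin : 0 < θmin)
    (hσ : 0 < σ) (hθ : θmin * σ ^ j ≤ θ) : |x - y| ≤ geomWidth C θmin (ϑ / σ) j * θ := by
  have h0 : 0 ≤ C * ϑ ^ j := (abs_nonneg _).trans h
  have hd : 0 < θmin * σ ^ j := mul_pos hmin (pow_pos hσ _)
  have hw : geomWidth C θmin (ϑ / σ) j = C * ϑ ^ j / (θmin * σ ^ j) := by
    simp only [geomWidth, div_pow]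
    field_simp
  have hw0 : 0 ≤ geomWidth C θmin (ϑ / σ) j := by rw [hw]; exact div_nonneg h0 hd.le
  calc |x - y| = |y - x| := abs_sub_comm x y
    _ ≤ C * ϑ ^ j := h
    _ = geomWidth C θmin (ϑ / σ) j * (θmin * σ ^ j) := by rw [hw, div_mul_cancel₀ _ hd.ne']
    _ ≤ geomWidth C θmin (ϑ / σ) j * θ := mul_le_mul_of_nonneg_left hθ hw0

/-- The comparison width `geomWidth C θmin (ϑ/σ)` is nonnegative for `0 ≤ C`, `0 ≤ θmin`, `0 ≤ ϑ`, `0 < σ`. [folklore] -/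
theorem geomWidth_div_nonneg {C ϑ : ℝ} (hC : 0 ≤ C) (hθ : 0 ≤ θmin) (hϑ0 : 0 ≤ ϑ) (hσ : 0 < σ) (j : ℕ) :
    0 ≤ geomWidth C θmin (ϑ / σ) j :=
  geomWidth_nonneg hC hθ (div_nonneg hϑ0 hσ.le) j

/-- … and summable as soon as the thresholds decay SLOWER than NE3's rate: `0 ≤ ϑ < σ`. [folklore] -/
theorem summable_geomWidth_div {C ϑ : ℝ} (hϑ0 : 0 ≤ ϑ) (hσ : 0 < σ) (hlt : ϑ < σ) :
    Summable (geomWidth C θmin (ϑ / σ)) :=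
  summable_geomWidth (div_nonneg hϑ0 hσ.le) ((div_lt_one hσ).2 hlt)

/-- … with total `(C/θmin)(1 − ϑ/σ)⁻¹`. [folklore] -/
theorem tsum_geomWidth_div {C ϑ : ℝ} (hϑ0 : 0 ≤ ϑ) (hσ : 0 < σ) (hlt : ϑ < σ) :
    ∑' j, geomWidth C θmin (ϑ / σ) j = C / θmin * (1 - ϑ / σ)⁻¹ :=
  tsum_geomWidth (div_nonneg hϑ0 hσ.le) ((div_lt_one hσ).2 hlt)

variable {R : Readings Dat Sit} {C ϑ : ℝ} {μ : (K : ℕ) → (τ : ι) → Measure (Ω K τ)}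
  {uA uB : (K : ℕ) → (τ : ι) → ℕ → Ω K τ → ℝ}

/-- **(L1-decay) THE LIAISON U1b → U5b WITHOUT A FLOOR.**  Node U1b's `LocalRate R C ϑ`, realised through `ReadsLevels`,
with thresholds `≥ θmin σ^j` by level (`θmin, σ > 0`), gives the (η) ledger's binder (F∞) `T4LipschitzLedger.SupClose` with
the width `ρ_j = (C/θmin)(ϑ/σ)^j`.  No sign hypothesis on `C` or `ϑ`; summability is `summable_geomWidth_div` (`ϑ < σ`).
[folklore] -/
theorem supClose_of_localRate_decay (hloc : LocalRate R C ϑ) (hR : ReadsLevels R T μ m slot uA uB)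
    (hmin : 0 < θmin) (hσ : 0 < σ) (hθ : ThresholdDecay T m slot θ θmin σ) :
    SupClose T μ m slot θ uA uB (geomWidth C θmin (ϑ / σ)) := by
  intro K τ hτ i hi
  filter_upwards [hR K τ hτ i hi] with v hv
  obtain ⟨V, hV, x, hX, hY⟩ := hv
  rw [hX, hY]
  exact abs_sub_le_geomWidth_div_mul (hloc _ V hV x) hmin hσ (hθ K τ hτ i hi)

/-- (L1-decay, runs swapped). [folklore] -/
theorem supClose_of_localRate_decay_symm (hloc : LocalRate R C ϑ) (hR : ReadsLevels R T μ m slot uA uB)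
    (hmin : 0 < θmin) (hσ : 0 < σ) (hθ : ThresholdDecay T m slot θ θmin σ) :
    SupClose T μ m slot θ uB uA (geomWidth C θmin (ϑ / σ)) :=
  (supClose_of_localRate_decay hloc hR hmin hσ hθ).symm

/-- (L1) is (L1-decay) at `σ = 1` (consistency of the two forms: the same width). [folklore] -/
theorem supClose_of_localRate_eq_decay_one (hloc : LocalRate R C ϑ) (hR : ReadsLevels R T μ m slot uA uB)
    (hmin : 0 < θmin) (hθ : ThresholdFloor T m θ θmin) :
    SupClose T μ m slot θ uA uB (geomWidth C θmin (ϑ / 1)) :=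
  supClose_of_localRate_decay hloc hR hmin one_pos (hθ.decay_one (slot := slot))

/-- REAL ANALYSIS: a geometric sequence is eventually below every negative power — quantitatively, for `0 < σ < 1` and
`p : ℕ` there is `c > 0` with `c·σ^k ≤ ((k+1)^p)⁻¹` for ALL `k` (`(k+1)^p σ^k → 0` is bounded;
`tendsto_pow_const_mul_const_pow_of_lt_one`). [folklore] -/
theorem exists_geom_le_inv_pow_succ {σ : ℝ} (hσ0 : 0 < σ) (hσ1 : σ < 1) (p : ℕ) :
    ∃ c : ℝ, 0 < c ∧ ∀ k : ℕ, c * σ ^ k ≤ (((k : ℝ) + 1) ^ p)⁻¹ := by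
  have ht : Tendsto (fun k : ℕ => ((k : ℝ) + 1) ^ p * σ ^ k) atTop (𝓝 0) := by
    have h1 := (tendsto_pow_const_mul_const_pow_of_lt_one p hσ0.le hσ1).comp (tendsto_add_atTop_nat 1)
    have h2 : Tendsto (fun k : ℕ => ((((k + 1 : ℕ) : ℝ)) ^ p * σ ^ (k + 1)) * σ⁻¹) atTop (𝓝 (0 * σ⁻¹)) :=
      h1.mul_const _
    rw [zero_mul] at h2
    refine h2.congr fun k => ?_
    rw [pow_succ, Nat.cast_add, Nat.cast_one]
    field_simp
  obtain ⟨M, hM⟩ := isBounded_iff_forall_norm_le.1 (Metric.isBounded_range_of_tendsto _ ht)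
  have hM' : ∀ k : ℕ, ((k : ℝ) + 1) ^ p * σ ^ k ≤ max M 1 := fun k =>
    ((le_abs_self _).trans (by simpa using hM _ (Set.mem_range_self k))).trans (le_max_left _ _)
  have hpos : 0 < max M 1 := lt_of_lt_of_le one_pos (le_max_right _ _)
  refine ⟨(max M 1)⁻¹, inv_pos.2 hpos, fun k => ?_⟩
  have hk : 0 < ((k : ℝ) + 1) ^ p := by positivity
  rw [inv_mul_le_iff₀ hpos, le_mul_inv_iff₀ hk, mul_comm]
  exact hM' k

/-- **THRESHOLDS DECAYING AT MOST POLYNOMIALLY IN THE LEVEL SATISFY `ThresholdDecay` FOR EVERY RATE `σ ∈ (0,1)`.**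
If every threshold is at least `A·(j+1)^{−p}` at level `j = K − a_i` (`A > 0`), then for each `0 < σ < 1` there is
`θmin > 0` with `ThresholdDecay T m slot θ θmin σ` — so (L1-decay) applies with ANY `σ ∈ (ϑ, 1)` and the width
`(C/θmin)(ϑ/σ)^j` is summable.  KERNEL IMPLICATION ONLY (v1.2 DOCFIX D1, cross-read O-pv16g12-10): the hypothesis is
indexed by the LEVEL and is largest (`θ ≥ A`) at level `0`; B14 (2.17)'s thresholds under asymptotic freedom are small
in the AGE `K − j` instead and vanish at level `0` as `K → ∞`, so an age-indexed family does NOT meet this hypothesis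
uniformly in `K` (`Toy.not_thresholdDecay_old`, §5e); its dictionary is `thresholdFloor_of_agePolyLower_window` (§5d),
THROUGH the window.  v1.1's clause here «the edge U1b → U5b needs of the thresholds only sub-geometric decay, not a
floor» is withdrawn. [folklore] -/
theorem thresholdDecay_of_polyLower {A σ : ℝ} {p : ℕ} (hA : 0 < A) (hσ0 : 0 < σ) (hσ1 : σ < 1)
    (hθ : ∀ K, ∀ τ ∈ T K, ∀ i < m K τ,
      A * ((((K - (slot K τ i).1 : ℕ) : ℝ) + 1) ^ p)⁻¹ ≤ θ K τ i) :
    ∃ θmin : ℝ, 0 < θmin ∧ ThresholdDecay T m slot θ θmin σ := by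
  obtain ⟨c, hc, hck⟩ := exists_geom_le_inv_pow_succ hσ0 hσ1 p
  refine ⟨A * c, mul_pos hA hc, fun K τ hτ i hi => ?_⟩
  calc A * c * σ ^ (K - (slot K τ i).1) = A * (c * σ ^ (K - (slot K τ i).1)) := by ring
    _ ≤ A * ((((K - (slot K τ i).1 : ℕ) : ℝ) + 1) ^ p)⁻¹ := mul_le_mul_of_nonneg_left (hck _) hA.le
    _ ≤ θ K τ i := hθ K τ hτ i hi

end Decay

/-! ### §5b By name into the (η) ledger with the decay form -/

section EndToEndDecay

variable {Dat Sit : Type*} {ι : Type*} {Ω : ℕ → ι → Type*} [∀ K τ, MeasurableSpace (Ω K τ)]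
  {l₀ vol : ℝ} {T : ℕ → Finset ι} {A B : ℕ → ℝ → ι → ℝ} {χ : ℕ → ℝ → ℝ} {κ Lχ : ℕ → ℝ} {N : ℕ} {n : ℕ → ℕ}
  {μ : (K : ℕ) → (τ : ι) → Measure (Ω K τ)} {m : ℕ → ι → ℕ} {slot : ℕ → ι → ℕ → Σ _ : ℕ, ℕ}
  {pol : ℕ → ι → ℕ → Pol} {θ : ℕ → ι → ℕ → ℝ} {uA uB : (K : ℕ) → (τ : ι) → ℕ → Ω K τ → ℝ}
  {RA RB : (K : ℕ) → ℝ → (τ : ι) → Ω K τ → ℝ} {S W δ : ℕ → ℝ} {Bad : ℕ → ℝ → Finset ι}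
  {R : Readings Dat Sit} {C ϑ θmin σ : ℝ}

/-- **(L2-decay) `T4LipschitzLedger.shellWeightBound_of_repr` WITH THE TWO-RUN WIDTH DISCHARGED, NO FLOOR:** as
`shellWeightBound_of_localRate` with `ThresholdFloor` replaced by `ThresholdDecay θmin σ`, `0 < σ`, `ϑ < σ`; the width is
`geomWidth C θmin (ϑ/σ)` (`hF` := `supClose_of_localRate_decay`, `hρ0` := `geomWidth_div_nonneg`, `hρ` :=
`summable_geomWidth_div`).  `ϑ < 1` is not even needed — only `ϑ < σ`. [folklore] -/
theorem shellWeightBound_of_localRate_decay (hA : TermRepr l₀ T A χ κ Lχ N n μ m slot pol θ uA uB RA)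
    (hB : TermRepr l₀ T B χ κ Lχ N n μ m slot pol θ uB uA RB)
    (hloc : LocalRate R C ϑ) (hC : 0 ≤ C) (hϑ0 : 0 ≤ ϑ) (hσ : 0 < σ) (hlt : ϑ < σ)
    (hR : ReadsLevels R T μ m slot uA uB) (hmin : 0 < θmin) (hθ : ThresholdDecay T m slot θ θmin σ)
    (hSA : SiblingSuppression l₀ T A N n (sibW χ κ μ m slot pol θ uA RA (geomWidth C θmin (ϑ / σ))) S)
    (hSB : SiblingSuppression l₀ T B N n (sibW χ κ μ m slot pol θ uB RB (geomWidth C θmin (ϑ / σ))) S)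
    (hS : ∀ a ≤ N, 0 ≤ S a) :
    ShellWeightBound l₀ T A B (shellW χ μ m slot pol θ uA uB RA) (shellW χ μ m slot pol θ uB uA RB)
      (fun K => ∑ a ∈ range (N + 1), (n a : ℝ) * lipWeight Lχ S (geomWidth C θmin (ϑ / σ)) a K) :=
  T4LipschitzLedger.shellWeightBound_of_repr hA hB (supClose_of_localRate_decay hloc hR hmin hσ hθ) hSA hSB hS
    (geomWidth_div_nonneg hC hmin.le hϑ0 hσ) (summable_geomWidth_div hϑ0 hσ hlt)

/-- **(L2-decay, END TO END) `T4LipschitzLedger.cauchy_of_repr` WITH THE TWO-RUN WIDTH DISCHARGED, NO FLOOR**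
(CONDITIONAL kernel theorem; every estimate a binder; as `cauchy_of_localRate` with the floor replaced by
`ThresholdDecay θmin σ`, `0 < σ`, `ϑ < σ`, width `geomWidth C θmin (ϑ/σ)`).  Nothing of Bałaban's is asserted.
[folklore] -/
theorem cauchy_of_localRate_decay [DecidableEq ι] {Z : ℕ → ℝ → ℝ} (hvol : 0 < vol) (hl₀ : 0 ≤ l₀)
    (hW : RelWeightBound l₀ T A B Bad W)
    (hA : TermRepr l₀ T A χ κ Lχ N n μ m slot pol θ uA uB RA) (hB : TermRepr l₀ T B χ κ Lχ N n μ m slot pol θ uB uA RB)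
    (hloc : LocalRate R C ϑ) (hC : 0 ≤ C) (hϑ0 : 0 ≤ ϑ) (hσ : 0 < σ) (hlt : ϑ < σ)
    (hR : ReadsLevels R T μ m slot uA uB) (hmin : 0 < θmin) (hθ : ThresholdDecay T m slot θ θmin σ)
    (hSA : SiblingSuppression l₀ T A N n (sibW χ κ μ m slot pol θ uA RA (geomWidth C θmin (ϑ / σ))) S)
    (hSB : SiblingSuppression l₀ T B N n (sibW χ κ μ m slot pol θ uB RB (geomWidth C θmin (ϑ / σ))) S)
    (hS : ∀ a ≤ N, 0 ≤ S a)
    (hltW : ∀ K, W K + ∑ a ∈ range (N + 1), (n a : ℝ) * lipWeight Lχ S (geomWidth C θmin (ϑ / σ)) a K < 1)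
    (hZA : ∀ K t, |t| ≤ l₀ → Z K t = ∑ τ ∈ T K, A K t τ)
    (hZB : ∀ K t, |t| ≤ l₀ → Z (K + 1) t = ∑ τ ∈ T K, B K t τ)
    (hpos : ∀ K t, |t| ≤ l₀ → 0 < ∑ τ ∈ T K, A K t τ) (hδ : Summable δ) {c : ℕ → ℝ}
    (hsw : ∀ K t, |t| ≤ l₀ → ∀ τ ∈ T K \ Bad K t,
      (∀ᵐ v ∂(μ K τ), Real.exp (c K - vol * δ K) * RA K t τ v ≤ RB K t τ v) ∧
        (∀ᵐ v ∂(μ K τ), RB K t τ v ≤ Real.exp (c K + vol * δ K) * RA K t τ v)) :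
    MatchingModConstants vol l₀
        (hybridDelta vol δ
          (fun K => W K + ∑ a ∈ range (N + 1), (n a : ℝ) * lipWeight Lχ S (geomWidth C θmin (ϑ / σ)) a K))
        Z ∧
      Summable
        (hybridDelta vol δ
          (fun K => W K + ∑ a ∈ range (N + 1), (n a : ℝ) * lipWeight Lχ S (geomWidth C θmin (ϑ / σ)) a K)) ∧
      (∀ t : ℝ, |t| ≤ l₀ → CauchySeq fun K => genFun Z K t) ∧
      TendstoUniformlyOn (fun K t => genFun Z K t) (genFunLim Z) atTop {t | |t| ≤ l₀} :=
  T4LipschitzLedger.cauchy_of_repr hvol hl₀ hW hA hB (supClose_of_localRate_decay hloc hR hmin hσ hθ) hSA hSB hS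
    (geomWidth_div_nonneg hC hmin.le hϑ0 hσ) (summable_geomWidth_div hϑ0 hσ hlt) hltW hZA hZB hpos hδ hsw

/-- (L3-decay) THE PRICE IN CLOSED FORM with the decay form: `Σ_K Wsh_K = C₀(n, L·S) · (C/θmin)(1 − ϑ/σ)⁻¹`
(`tsum_bandWeight_eq` at rate `ϑ/σ`). [folklore] -/
theorem tsum_bandWeight_eq_decay {N : ℕ} (n : ℕ → ℕ) (Lχ S : ℕ → ℝ) {C θmin ϑ σ : ℝ} (hϑ0 : 0 ≤ ϑ) (hσ : 0 < σ)
    (hlt : ϑ < σ) :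
    ∑' K, (∑ a ∈ range (N + 1), (n a : ℝ) * lipWeight Lχ S (geomWidth C θmin (ϑ / σ)) a K)
      = C0 N (fun a => (n a : ℝ)) (fun a => Lχ a * S a) * (C / θmin * (1 - ϑ / σ)⁻¹) :=
  tsum_bandWeight_eq n Lχ S (div_nonneg hϑ0 hσ.le) ((div_lt_one hσ).2 hlt)

end EndToEndDecay

/-! ### §5c The decay form on the one-slot toy: no floor, still a summable width -/

namespace Toy

open T4EtaRateMin.Witness (geom)

/-- Toy: a threshold DECAYING with the step, `θ_K = (3/4)^K` (the factor has age `0`, so its level is `K`). [folklore] -/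
noncomputable abbrev θdec : ℕ → Unit → ℕ → ℝ := fun K _ _ => (3 / 4) ^ K

/-- The decaying toy threshold satisfies `ThresholdDecay` with `(θmin, σ) = (1, 3/4)`. [folklore] -/
theorem thresholdDecay_dec : ThresholdDecay T m slot θdec 1 (3 / 4) := by
  intro K τ _ i _
  simp

/-- … and has NO positive floor (`(3/4)^K → 0`): the decay form is strictly weaker than the floor. [folklore] -/
theorem not_thresholdFloor_dec : ¬ ∃ θmin : ℝ, 0 < θmin ∧ ThresholdFloor T m θdec θmin := by
  rintro ⟨θmin, hpos, h⟩
  have ht : Tendsto (fun K : ℕ => ((3 : ℝ) / 4) ^ K) atTop (𝓝 0) :=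
    tendsto_pow_atTop_nhds_zero_of_lt_one (by norm_num) (by norm_num)
  obtain ⟨K, hK⟩ := (ht.eventually (gt_mem_nhds hpos)).exists
  have hfloor : θmin ≤ ((3 : ℝ) / 4) ^ K := h K () (Finset.mem_singleton_self _) 0 Nat.one_pos
  exact (not_lt.2 hfloor) hK

/-- NON-VACUITY OF (L1-decay) WITHOUT A FLOOR: the geometric readings `(1/2)^k` with the decaying thresholds `(3/4)^K`
give `SupClose` with width `geomWidth 1 1 ((1/2)/(3/4)) j = (2/3)^j`. [folklore] -/
theorem supClose_decay :
    SupClose (Ω := fun _ _ => Unit) T μ m slot θdec (uA geom) (uB geom) (geomWidth 1 1 ((1 / 2) / (3 / 4))) :=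
  supClose_of_localRate_decay T4EtaRateMin.Witness.ne3Shape.pointwise (readsLevels geom rfl) one_pos (by norm_num)
    thresholdDecay_dec

/-- … that width is `(2/3)^j` … [folklore] -/
theorem geomWidth_decay_toy (j : ℕ) : geomWidth 1 1 ((1 / 2) / (3 / 4) : ℝ) j = (2 / 3) ^ j := by
  rw [geomWidth_apply]; norm_num

/-- … summable (the thresholds decay at rate `3/4`, slower than the readings' rate `1/2`), with total `3`. [folklore] -/
theorem summable_width_decay : Summable (geomWidth 1 1 ((1 / 2) / (3 / 4) : ℝ)) :=
  summable_geomWidth_div (by norm_num) (by norm_num) (by norm_num)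

/-- … with total `3`. [folklore] -/
theorem tsum_width_decay : ∑' j, geomWidth 1 1 ((1 / 2) / (3 / 4) : ℝ) j = 3 := by
  rw [tsum_geomWidth_div (by norm_num) (by norm_num) (by norm_num)]; norm_num

end Toy

/-! ## §5d (v1.2) Age-indexed thresholds: the window, not decay, is the booking

Row T4-U1b.S-FINFTY-AGE° (journal `CLAIMS.log` 2026-08-19, unit `b2b-balaban-pv25-g12`, self-proposed under the yield
clause; acting on the cross-read of v1.1, cell GAPS C-pv16g12-9 / O-pv16g12-10 — CONCEDED).  B14 (2.17) p. 257 puts the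
model slot's threshold at `ε_kη²`, `ε_k = A₀g_kp₀(g_k)`: a function of the running coupling OF THE FACTOR'S LEVEL.  At
fixed physical coupling an asymptotically free coupling is small at the OLD levels (deep ultraviolet), so in units common
to the two runs such a threshold is bounded below by a function of the factor's AGE `a = K − j` which may tend to `0` as
the age grows — the TYPE `AgeLower T m slot θ f` below (whether, and with which `f`, Bałaban's sequence has it is the β
cell's business — BETA-SPEC `Step.Discrete031` —; NOTHING is asserted here).  An age-indexed lower bound alone gives
neither `ThresholdFloor` nor `ThresholdDecay` uniformly in `K` (§5e: kernel witnesses), and for NE3-shaped readings not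
even SOME level-indexed `SupClose` width; what converts it into the `K`-uniform floor of HONEST LIMITS (b) is node U2's
WINDOW OF AGES `a ≤ N` (T4-DAG §1 D8) — which pv07's representation convention ALREADY carries as the field
`TermRepr.slot_mem`.  Hence (L2-age): the floor binder of (L2) is discharged from `AgeLower f` and `0 < θmin ≤ f a`
(`a ≤ N`) with no separate window hypothesis.  All [folklore]; no print side; every v1.1 declaration above unchanged. -/

section Age

variable {Dat Sit : Type*} {ι : Type*} {Ω : ℕ → ι → Type*} [∀ K τ, MeasurableSpace (Ω K τ)]

/-- **AGE-INDEXED THRESHOLD LOWER BOUND** (the (2.17)+AF TYPE of the cross-read O-pv16g12-10; a `def … : Prop`, never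
asserted): the threshold of factor `i` of term `τ ∈ T K` — a slot of AGE `a_i = (slot K τ i).1` — is at least `f a_i`.
[folklore] -/
def AgeLower (T : ℕ → Finset ι) (m : ℕ → ι → ℕ) (slot : ℕ → ι → ℕ → Σ _ : ℕ, ℕ) (θ : ℕ → ι → ℕ → ℝ)
    (f : ℕ → ℝ) : Prop :=
  ∀ K, ∀ τ ∈ T K, ∀ i < m K τ, f (slot K τ i).1 ≤ θ K τ i

/-- **THE WINDOW OF AGES** (node U2's design datum `N`, T4-DAG §1 D8; a `def … : Prop`): every live factor of every
term has age `≤ N`. [folklore] -/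
def AgeWindow (T : ℕ → Finset ι) (m : ℕ → ι → ℕ) (slot : ℕ → ι → ℕ → Σ _ : ℕ, ℕ) (N : ℕ) : Prop :=
  ∀ K, ∀ τ ∈ T K, ∀ i < m K τ, (slot K τ i).1 ≤ N

variable {T : ℕ → Finset ι} {m : ℕ → ι → ℕ} {slot : ℕ → ι → ℕ → Σ _ : ℕ, ℕ} {θ : ℕ → ι → ℕ → ℝ} {f : ℕ → ℝ}
  {N : ℕ} {θmin : ℝ}

/-- pv07's representation convention CARRIES the window: the field `TermRepr.slot_mem`
(`slot K τ i ∈ (range (N+1)).sigma _`) gives `AgeWindow T m slot N`. [folklore] -/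
theorem ageWindow_of_termRepr {l₀ : ℝ} {X : ℕ → ℝ → ι → ℝ} {χ : ℕ → ℝ → ℝ} {κ Lχ : ℕ → ℝ} {n : ℕ → ℕ}
    {μ : (K : ℕ) → (τ : ι) → Measure (Ω K τ)} {pol : ℕ → ι → ℕ → Pol}
    {uX uY : (K : ℕ) → (τ : ι) → ℕ → Ω K τ → ℝ} {RX : (K : ℕ) → ℝ → (τ : ι) → Ω K τ → ℝ}
    (h : TermRepr l₀ T X χ κ Lχ N n μ m slot pol θ uX uY RX) : AgeWindow T m slot N :=
  fun K τ hτ i hi => Finset.mem_range_succ_iff.1 (Finset.mem_sigma.1 (h.slot_mem K τ hτ i hi)).1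

/-- A window may be enlarged. [folklore] -/
theorem AgeWindow.mono {N' : ℕ} (h : AgeWindow T m slot N) (hle : N ≤ N') : AgeWindow T m slot N' :=
  fun K τ hτ i hi => (h K τ hτ i hi).trans hle

/-- An age-indexed lower bound may be lowered pointwise. [folklore] -/
theorem AgeLower.mono {g : ℕ → ℝ} (h : AgeLower T m slot θ f) (hle : ∀ a, g a ≤ f a) : AgeLower T m slot θ g :=
  fun K τ hτ i hi => (hle _).trans (h K τ hτ i hi)

/-- A floor is the constant age-indexed lower bound. [folklore] -/
theorem ThresholdFloor.ageLower_const (h : ThresholdFloor T m θ θmin) : AgeLower T m slot θ (fun _ => θmin) :=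
  fun K τ hτ i hi => h K τ hτ i hi

/-- **THE DICTIONARY: AGE-INDEXED LOWER BOUND + WINDOW ⟹ FLOOR.**  If every factor of age `a` has threshold `≥ f a`,
every live factor has age `≤ N`, and `θmin ≤ f a` for `a ≤ N`, then `ThresholdFloor T m θ θmin`. [folklore] -/
theorem thresholdFloor_of_ageLower_window (hf : AgeLower T m slot θ f) (hN : AgeWindow T m slot N)
    (hmin : ∀ a ≤ N, θmin ≤ f a) : ThresholdFloor T m θ θmin :=
  fun K τ hτ i hi => (hmin _ (hN K τ hτ i hi)).trans (hf K τ hτ i hi)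

/-- … in particular an age-indexed lower bound POSITIVE ON THE WINDOW yields SOME positive floor (the minimum of `f`
over the finitely many ages `a ≤ N`). [folklore] -/
theorem exists_thresholdFloor_of_ageLower_window (hf : AgeLower T m slot θ f) (hN : AgeWindow T m slot N)
    (hpos : ∀ a ≤ N, 0 < f a) : ∃ θmin : ℝ, 0 < θmin ∧ ThresholdFloor T m θ θmin := by
  obtain ⟨a₀, ha₀, hle⟩ :=
    Finset.exists_min_image (range (N + 1)) f ⟨0, Finset.mem_range.2 (Nat.succ_pos N)⟩
  refine ⟨f a₀, hpos a₀ (Finset.mem_range_succ_iff.1 ha₀),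
    thresholdFloor_of_ageLower_window hf hN fun a ha => ?_⟩
  exact hle a (Finset.mem_range_succ_iff.2 ha)

/-- **THE (2.17)+AF DICTIONARY** (the cross-read O-pv16g12-10, item (3c), in the kernel): thresholds at least
`A·(a+1)^{−p}` in the AGE `a` (`A ≥ 0`) on a window of ages `≤ N` have the floor `θmin = A·(N+1)^{−p}` — node U2's
window converts age-smallness into the `K`-uniform floor of HONEST LIMITS (b), at the price `(N+1)^p` in `C/θmin`.
[folklore] -/
theorem thresholdFloor_of_agePolyLower_window {A : ℝ} {p : ℕ} (hA : 0 ≤ A)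
    (hθ : ∀ K, ∀ τ ∈ T K, ∀ i < m K τ, A * (((((slot K τ i).1 : ℕ) : ℝ) + 1) ^ p)⁻¹ ≤ θ K τ i)
    (hN : AgeWindow T m slot N) : ThresholdFloor T m θ (A * ((((N : ℕ) : ℝ) + 1) ^ p)⁻¹) := by
  refine thresholdFloor_of_ageLower_window (f := fun a => A * ((((a : ℕ) : ℝ) + 1) ^ p)⁻¹) hθ hN fun a ha => ?_
  have hcast : ((a : ℕ) : ℝ) + 1 ≤ ((N : ℕ) : ℝ) + 1 := by
    have : ((a : ℕ) : ℝ) ≤ ((N : ℕ) : ℝ) := by exact_mod_cast ha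
    linarith
  have hpow : (((a : ℕ) : ℝ) + 1) ^ p ≤ (((N : ℕ) : ℝ) + 1) ^ p := pow_le_pow_left₀ (by positivity) hcast p
  exact mul_le_mul_of_nonneg_left (inv_anti₀ (by positivity) hpow) hA

variable {R : Readings Dat Sit} {C ϑ : ℝ} {μ : (K : ℕ) → (τ : ι) → Measure (Ω K τ)}
  {uA uB : (K : ℕ) → (τ : ι) → ℕ → Ω K τ → ℝ}

/-- **(L1-age) THE LIAISON U1b → U5b FROM AN AGE-INDEXED LOWER BOUND ON A WINDOW:** `LocalRate R C ϑ` + `ReadsLevels`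
+ `AgeLower f` + `AgeWindow N` + `0 < θmin ≤ f a (a ≤ N)` ⟹ `SupClose … (geomWidth C θmin ϑ)` — (L1) with its floor
discharged by `thresholdFloor_of_ageLower_window`. [folklore] -/
theorem supClose_of_localRate_ageLower (hloc : LocalRate R C ϑ) (hR : ReadsLevels R T μ m slot uA uB)
    (hf : AgeLower T m slot θ f) (hN : AgeWindow T m slot N) (hmin : 0 < θmin) (hfmin : ∀ a ≤ N, θmin ≤ f a) :
    SupClose T μ m slot θ uA uB (geomWidth C θmin ϑ) :=
  supClose_of_localRate hloc hR hmin (thresholdFloor_of_ageLower_window hf hN hfmin)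

end Age

/-! ### §5d′ By name into the (η) ledger from an age-indexed lower bound — the window is `TermRepr`'s own -/

section EndToEndAge

variable {Dat Sit : Type*} {ι : Type*} {Ω : ℕ → ι → Type*} [∀ K τ, MeasurableSpace (Ω K τ)]
  {l₀ vol : ℝ} {T : ℕ → Finset ι} {A B : ℕ → ℝ → ι → ℝ} {χ : ℕ → ℝ → ℝ} {κ Lχ : ℕ → ℝ} {N : ℕ} {n : ℕ → ℕ}
  {μ : (K : ℕ) → (τ : ι) → Measure (Ω K τ)} {m : ℕ → ι → ℕ} {slot : ℕ → ι → ℕ → Σ _ : ℕ, ℕ}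
  {pol : ℕ → ι → ℕ → Pol} {θ : ℕ → ι → ℕ → ℝ} {uA uB : (K : ℕ) → (τ : ι) → ℕ → Ω K τ → ℝ}
  {RA RB : (K : ℕ) → ℝ → (τ : ι) → Ω K τ → ℝ} {S W δ : ℕ → ℝ} {Bad : ℕ → ℝ → Finset ι}
  {R : Readings Dat Sit} {C ϑ θmin : ℝ} {f : ℕ → ℝ}

/-- **(L2-age) `T4LipschitzLedger.shellWeightBound_of_repr` WITH THE TWO-RUN WIDTH DISCHARGED FROM AN AGE-INDEXED
THRESHOLD LOWER BOUND:** as `shellWeightBound_of_localRate`, the floor binder replaced by `AgeLower f` and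
`0 < θmin ≤ f a (a ≤ N)`; the window of ages is NOT a hypothesis — it is the field `slot_mem` of the two `TermRepr`
hypotheses (`ageWindow_of_termRepr`). [folklore] -/
theorem shellWeightBound_of_localRate_ageLower (hA : TermRepr l₀ T A χ κ Lχ N n μ m slot pol θ uA uB RA)
    (hB : TermRepr l₀ T B χ κ Lχ N n μ m slot pol θ uB uA RB)
    (hloc : LocalRate R C ϑ) (hC : 0 ≤ C) (hϑ0 : 0 ≤ ϑ) (hϑ1 : ϑ < 1)
    (hR : ReadsLevels R T μ m slot uA uB) (hf : AgeLower T m slot θ f) (hmin : 0 < θmin)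
    (hfmin : ∀ a ≤ N, θmin ≤ f a)
    (hSA : SiblingSuppression l₀ T A N n (sibW χ κ μ m slot pol θ uA RA (geomWidth C θmin ϑ)) S)
    (hSB : SiblingSuppression l₀ T B N n (sibW χ κ μ m slot pol θ uB RB (geomWidth C θmin ϑ)) S)
    (hS : ∀ a ≤ N, 0 ≤ S a) :
    ShellWeightBound l₀ T A B (shellW χ μ m slot pol θ uA uB RA) (shellW χ μ m slot pol θ uB uA RB)
      (fun K => ∑ a ∈ range (N + 1), (n a : ℝ) * lipWeight Lχ S (geomWidth C θmin ϑ) a K) :=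
  shellWeightBound_of_localRate hA hB hloc hC hϑ0 hϑ1 hR hmin
    (thresholdFloor_of_ageLower_window hf (ageWindow_of_termRepr hA) hfmin) hSA hSB hS

/-- **(L2-age, END TO END) `T4LipschitzLedger.cauchy_of_repr` WITH THE TWO-RUN WIDTH DISCHARGED FROM AN AGE-INDEXED
THRESHOLD LOWER BOUND** (CONDITIONAL kernel theorem; every estimate a binder; as `cauchy_of_localRate` with the floor
replaced by `AgeLower f` + `0 < θmin ≤ f a (a ≤ N)`, the window read off `TermRepr.slot_mem`).  Nothing of Bałaban's is
asserted. [folklore] -/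
theorem cauchy_of_localRate_ageLower [DecidableEq ι] {Z : ℕ → ℝ → ℝ} (hvol : 0 < vol) (hl₀ : 0 ≤ l₀)
    (hW : RelWeightBound l₀ T A B Bad W)
    (hA : TermRepr l₀ T A χ κ Lχ N n μ m slot pol θ uA uB RA) (hB : TermRepr l₀ T B χ κ Lχ N n μ m slot pol θ uB uA RB)
    (hloc : LocalRate R C ϑ) (hC : 0 ≤ C) (hϑ0 : 0 ≤ ϑ) (hϑ1 : ϑ < 1)
    (hR : ReadsLevels R T μ m slot uA uB) (hf : AgeLower T m slot θ f) (hmin : 0 < θmin)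
    (hfmin : ∀ a ≤ N, θmin ≤ f a)
    (hSA : SiblingSuppression l₀ T A N n (sibW χ κ μ m slot pol θ uA RA (geomWidth C θmin ϑ)) S)
    (hSB : SiblingSuppression l₀ T B N n (sibW χ κ μ m slot pol θ uB RB (geomWidth C θmin ϑ)) S)
    (hS : ∀ a ≤ N, 0 ≤ S a)
    (hlt : ∀ K, W K + ∑ a ∈ range (N + 1), (n a : ℝ) * lipWeight Lχ S (geomWidth C θmin ϑ) a K < 1)
    (hZA : ∀ K t, |t| ≤ l₀ → Z K t = ∑ τ ∈ T K, A K t τ)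
    (hZB : ∀ K t, |t| ≤ l₀ → Z (K + 1) t = ∑ τ ∈ T K, B K t τ)
    (hpos : ∀ K t, |t| ≤ l₀ → 0 < ∑ τ ∈ T K, A K t τ) (hδ : Summable δ) {c : ℕ → ℝ}
    (hsw : ∀ K t, |t| ≤ l₀ → ∀ τ ∈ T K \ Bad K t,
      (∀ᵐ v ∂(μ K τ), Real.exp (c K - vol * δ K) * RA K t τ v ≤ RB K t τ v) ∧
        (∀ᵐ v ∂(μ K τ), RB K t τ v ≤ Real.exp (c K + vol * δ K) * RA K t τ v)) :
    MatchingModConstants vol l₀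
        (hybridDelta vol δ (fun K => W K + ∑ a ∈ range (N + 1), (n a : ℝ) * lipWeight Lχ S (geomWidth C θmin ϑ) a K))
        Z ∧
      Summable
        (hybridDelta vol δ (fun K => W K + ∑ a ∈ range (N + 1), (n a : ℝ) * lipWeight Lχ S (geomWidth C θmin ϑ) a K)) ∧
      (∀ t : ℝ, |t| ≤ l₀ → CauchySeq fun K => genFun Z K t) ∧
      TendstoUniformlyOn (fun K t => genFun Z K t) (genFunLim Z) atTop {t | |t| ≤ l₀} :=
  cauchy_of_localRate hvol hl₀ hW hA hB hloc hC hϑ0 hϑ1 hR hmin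
    (thresholdFloor_of_ageLower_window hf (ageWindow_of_termRepr hA) hfmin) hSA hSB hS hlt hZA hZB hpos hδ hsw

end EndToEndAge

/-! ### §5e Kernel witnesses: age-indexed vanishing thresholds admit no floor, no decay form, no width — the window does -/

namespace Toy

open T4EtaRateMin.Witness (geom)

/-- Toy (age-indexed): the factor has AGE `K` — born at level `0`, the deepest ultraviolet, the OLDEST factor of the
`K`-th comparison — and copy index `0`. [folklore] -/
abbrev slotOld : ℕ → Unit → ℕ → Σ _ : ℕ, ℕ := fun K _ _ => ⟨K, 0⟩
/-- Toy: its threshold `(K+1)⁻¹` — polynomially small in the AGE (the (2.17)+AF type of the cross-read O-pv16g12-10),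
vanishing along `K`. [folklore] -/
noncomputable abbrev θold : ℕ → Unit → ℕ → ℝ := fun K _ _ => (((K : ℕ) : ℝ) + 1)⁻¹
/-- Toy: run A reads the level-`0` (`= K − K`) reading of the family `R`, … [folklore] -/
abbrev uAold (R : Readings Unit Unit) : (K : ℕ) → (τ : Unit) → ℕ → (fun _ _ => Unit) K τ → ℝ :=
  fun _ _ _ _ => R.loc 0 () ()
/-- Toy: … run B the level-`1` reading. [folklore] -/
abbrev uBold (R : Readings Unit Unit) : (K : ℕ) → (τ : Unit) → ℕ → (fun _ _ => Unit) K τ → ℝ :=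
  fun _ _ _ _ => R.loc 1 () ()

/-- Any family with all data admissible is realised by the old toy slot (`ReadsLevels` at level `K − K = 0`).
[folklore] -/
theorem readsLevels_old (R : Readings Unit Unit) (hR : R.dom = Set.univ) :
    ReadsLevels (Ω := fun _ _ => Unit) R T μ m slotOld (uAold R) (uBold R) := by
  intro K τ _ i _
  exact ae_of_all _ fun v => ⟨(), by simp [hR], (), by simp, by simp⟩

/-- The geometric readings `(1/2)^k` have NE3's shape `LocalRate geom 1 (1/2)` (`T4EtaRateMin.Witness.ne3Shape`) — the
two-run input of the liaison is PRESENT in the old toy. [folklore] -/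
theorem localRate_geom : LocalRate geom 1 (1 / 2) := T4EtaRateMin.Witness.ne3Shape.pointwise

/-- The old toy's thresholds obey the AGE-indexed lower bound `f a = (a+1)⁻¹` (with equality). [folklore] -/
theorem ageLower_old : AgeLower T m slotOld θold (fun a => (((a : ℕ) : ℝ) + 1)⁻¹) := fun _ _ _ _ _ => le_rfl

/-- … but its ages are unbounded: NO window of ages. [folklore] -/
theorem not_ageWindow_old : ¬ ∃ N, AgeWindow T m slotOld N := by
  rintro ⟨N, h⟩
  have hN : N + 1 ≤ N := h (N + 1) () (Finset.mem_singleton_self _) 0 Nat.one_pos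
  omega

/-- **NO `ThresholdDecay` FOR ANY `θmin > 0` AND ANY `σ`** (the cross-reader's probe J4 re-typed in the tree): the
factor sits at level `0`, where the decay form demands the full `θmin ≤ (K+1)⁻¹` for every `K`. [folklore] -/
theorem not_thresholdDecay_old : ¬ ∃ θmin σ : ℝ, 0 < θmin ∧ ThresholdDecay T m slotOld θold θmin σ := by
  rintro ⟨θmin, σ, hpos, h⟩
  have ht : Tendsto (fun K : ℕ => (((K : ℕ) : ℝ) + 1)⁻¹) atTop (𝓝 0) := by
    simpa only [one_div] using tendsto_one_div_add_atTop_nhds_zero_nat (𝕜 := ℝ)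
  obtain ⟨K, hK⟩ := (ht.eventually (gt_mem_nhds hpos)).exists
  have hdec : θmin * σ ^ (K - (slotOld K () 0).1) ≤ θold K () 0 :=
    h K () (Finset.mem_singleton_self _) 0 Nat.one_pos
  have hdec' : θmin ≤ (((K : ℕ) : ℝ) + 1)⁻¹ := by simpa using hdec
  exact (not_lt.2 hdec') hK

/-- … hence NO positive floor either (`ThresholdFloor` = decay at `σ = 1`). [folklore] -/
theorem not_thresholdFloor_old : ¬ ∃ θmin : ℝ, 0 < θmin ∧ ThresholdFloor T m θold θmin := by
  rintro ⟨θmin, hpos, h⟩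
  exact not_thresholdDecay_old ⟨θmin, 1, hpos, h.decay_one⟩

/-- **NO `SupClose` WIDTH AT ALL** for the NE3-shaped readings `(1/2)^k` realised on the old slot: run A reads level
`0` (value `1`), run B level `1` (value `1/2`) — a FIXED discrepancy `1/2` against a threshold `(K+1)⁻¹ → 0`; a width
`ρ` indexed by the LEVEL would need `ρ 0 · (K+1)⁻¹ ≥ 1/2` for every `K` (cross-read O-pv16g12-10, item (3c): a
level-indexed width cannot absorb an age-indexed vanishing threshold — only the window can). [folklore] -/
theorem not_supClose_old :
    ¬ ∃ ρ : ℕ → ℝ, SupClose (Ω := fun _ _ => Unit) T μ m slotOld θold (uAold geom) (uBold geom) ρ := by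
  rintro ⟨ρ, h⟩
  have h1 : ∀ K : ℕ, (1 / 2 : ℝ) ≤ ρ 0 * (((K : ℕ) : ℝ) + 1)⁻¹ := by
    intro K
    have hK : ∀ᵐ v ∂(Measure.dirac ()),
        |uAold geom K () 0 v - uBold geom K () 0 v| ≤ ρ (K - (slotOld K () 0).1) * θold K () 0 :=
      h K () (Finset.mem_singleton_self _) 0 Nat.one_pos
    obtain ⟨_, hv⟩ := hK.exists
    have hval : uAold geom K () 0 () - uBold geom K () 0 () = 1 / 2 := by
      simp only [uAold, uBold, geom]; norm_num
    have hval' : |uAold geom K () 0 () - uBold geom K () 0 ()| = 1 / 2 := by rw [hval]; norm_num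
    simpa [hval'] using hv
  have ht : Tendsto (fun K : ℕ => ρ 0 * (((K : ℕ) : ℝ) + 1)⁻¹) atTop (𝓝 (ρ 0 * 0)) :=
    (by simpa only [one_div] using tendsto_one_div_add_atTop_nhds_zero_nat (𝕜 := ℝ) :
      Tendsto (fun K : ℕ => (((K : ℕ) : ℝ) + 1)⁻¹) atTop (𝓝 0)).const_mul (ρ 0)
  rw [mul_zero] at ht
  obtain ⟨K, hK⟩ := (ht.eventually (gt_mem_nhds (by norm_num : (0 : ℝ) < 1 / 2))).exists
  exact (not_lt.2 (h1 K)) hK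

/-- CONTRAST — THE WINDOW RESCUES: the v1 toy slot (age `0`, threshold `1`) obeys the SAME age law `f a = (a+1)⁻¹` …
[folklore] -/
theorem ageLower_young : AgeLower T m slot θ (fun a => (((a : ℕ) : ℝ) + 1)⁻¹) := by
  intro K τ _ i _
  simp

/-- … has the window of ages `N = 0` … [folklore] -/
theorem ageWindow_young : AgeWindow T m slot 0 := fun _ _ _ _ _ => le_rfl

/-- … and (L1-age) returns `SupClose` with the floor width `geomWidth 1 1 (1/2) j = (1/2)^j` for the geometric readings
(all binders of `supClose_of_localRate_ageLower` inhabited at once; compare `not_supClose_old`). [folklore] -/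
theorem supClose_geom_age :
    SupClose (Ω := fun _ _ => Unit) T μ m slot θ (uA geom) (uB geom) (geomWidth 1 1 (1 / 2)) :=
  supClose_of_localRate_ageLower localRate_geom (readsLevels geom rfl) ageLower_young ageWindow_young one_pos
    fun a ha => by obtain rfl := Nat.le_zero.1 ha; norm_num

end Toy


end Literature.MathematicalPhysics.QuantumFieldTheory.Balaban1983to89.T4SupCloseLiaison
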